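import Literature.Barriers.NavierStokesRegularity.NavierStokesInequalityCantorSwitching
import Literature.Barriers.NavierStokesRegularity.NavierStokesInequalityArrangement
import Literature.Analysis.FluidPDE.ClassicalSolutionRescale
import Literature.Analysis.FluidPDE.NormalisedPressureAffine
import Literature.Analysis.FluidPDE.NormalisedPressureCompactSupport
import HarnessLib

/-!
# Scheffer's Cantor block, decomposed: the geometric arrangement for Theorem 14 (Ożański 2017, §6.2, §6.5)

Barrier catalogue support file for `NavierStokesRegularity` (D-0021), the layer under
`NavierStokesInequalityCantorSwitching`, which reduced Scheffer's 1987 theorem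
(`NavierStokesInequalityNearlyOneDimSingularSet`: a weak solution of the Navier–Stokes inequality
whose singular set `S × {T₀}` has `dim_H S ≥ ξ`, any `ξ ∈ (0,1)`) to the Cantor switching
principle (fact A′, `NSICantorSwitching`) and the existence of a Cantor block (fact B′,
`NSICantorBlockExists`: for every `ξ ∈ (0,1)` a family `IsNSICantorBlock` of classical pieces on
the generations of a Cantor dust with `τ^ξ M ≥ 1`, `τM < 1`). Fact B′ — the heart of Scheffer's
construction — is decomposed here along the seam PRINTED in W. S. Ożański, arXiv:1709.00602, §6.2
("Sketch of the proof of Theorem 14"): "As in the proof of Theorem 1, the proof is based on a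
geometric arrangement. Here we will need a certain sharper geometric arrangement as follows. …
We now show how Theorem 14 follows (given the geometric arrangement)" — the arrangement itself
being constructed in §6.5 ("The new geometric arrangement"), and the passage from the arrangement
to the pieces `u^{(j)}` being Proposition 16 (proved in §6.3–§6.4 with the new oscillatory
processes, Theorem 17) followed by the rescaling (6.13) and the derivation of (6.14)–(6.17) and of
the bounds of p. 30. In Scheffer's original (Comm. Math. Phys. 110 (1987)): §4 "The geometric
building blocks" (Lemmas 4.1–4.18) is the arrangement, §3 (Lemmas 3.1–3.2, the oscillatory
process) with Lemma 5.5 is Proposition 16, and (5.34)–(5.38) with Lemmas 5.6–5.8 is the rescaling.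
It is the `M`-adic twin of the accepted `NavierStokesInequalityArrangement` (facts C, D and
`C → D → NSIBlockExists` for the one-point blow-up), whose vocabulary (`IsNSIStructure`,
`revolve`, `meridian`, `pressureInteraction`, `IsNSIArrangement`) it reuses.

## What is printed (Ożański 2017, §6.2, pp. 28–30; §6.3 Step 1; §6.5, pp. 32–35)

"By the geometric arrangement (for Theorem 14) we mean a pair of open sets `U₁, U₂ ⋐ P` together
with the corresponding structures `(v₁,f₁,φ₁)`, `(v₂,f₂,φ₂)` such that `Ū₁ ∩ Ū₂ = ∅` and, for
some `T > 0`, `X > 0`, `τ ∈ (0,1)`, `z = (z₁,z₂,0) ∈ ℝ³`, `M ∈ ℕ`, (6.2) [`τ^ξ M ≥ 1`, `τM < 1`]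
and (6.3) [`{Γ_n(G)}_{n=1,…,M}` is a family of pairwise disjoint subsets of `G₂`] hold with
`G = G₁ ∪ G₂ := R(Ū₁ ∪ Ū₂)`, (6.6) `f₂² + T v₂·F[v₁,f₁] > |v₂|²` in `U₂`, and (6.7)
`f₂²(y_n) + T v₂(y_n)·F[v₁,f₁](y_n) > τ⁻²(f₁(R⁻¹x) + f₂(R⁻¹x))²` for all `x ∈ G` and
`n = 1,…,M`, where `y_n = R⁻¹(Γ_n(x))` and `Γ_n(x) = τx + z + (n-1)(X,0,0)`." "In fact, the
previous geometric arrangement is recovered if one takes `ξ = 0`, `M = 1`." §6.5 constructs it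
(Steps 1–5 and Lemma 18: the objects `U, v, f, φ, F, A, B, C, D, κ, a', r', s', a'', r'', s'',
H, E` of §5, `M` disjoint copies of `U ∪ U^{a',r'} ∪ U^{a'',r''}` in the `x₁` direction at
distance `X` ((6.33)), `τ = 0.48ε`, `r = E/ε`, `d = κr`, `M = 1 + d/(4X)` ((6.35)), `ε` small with
`τ^ξ M ≥ 1` ((6.36)), `z = (A, εr/2, 0)`, the ring `U₂`, `U₁ = ⋃ₙ(copies) ∪ U^{a,r}`, and — "as
previously" — `f₂, φ₂, T` as in §5.5).

Given the arrangement (§6.2, pp. 28–30): `θ > 0` small with (6.8); `h_t := h_{1,t} + h_{2,t}`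
((6.9)–(6.11): `h²_{1,t} = f₁² - 2tδφ₁`, `h²_{2,t} = f₂² - 2tδφ₂ + ∫₀ᵗ v₂·F[v₁,h_{1,s}] ds`,
`δ > 0` small, structures for `t ∈ (-δ, T+δ)`) with (6.12)
`h²_{2,T}(y_n) > τ⁻²(f₁(R⁻¹x) + f₂(R⁻¹x))² + θ` (`x ∈ G`, `n = 1,…,M`); `ν₀ > 0` as in (4.13);
and **Proposition 16**: for every `j ≥ 0`, with `h_t^{(j)}(x₁,x₂) := Σ_{m∈M(j)} h_t(π_m⁻¹(τʲx₁),x₂)`,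
a field `v^{(j)} ∈ C^∞(ℝ³ × [0,T]; ℝ³)` (:= smooth on `ℝ³ × (-η, T+η)`, some `η > 0`) with
(i) `div v^{(j)}(t) = 0`, `supp v^{(j)}(t) = R(supp h_t^{(j)})`; (ii) `|v^{(j)}(x,0)| = h₀^{(j)}(R⁻¹x)`,
`||v^{(j)}(x,t)|² - h_t^{(j)}(R⁻¹x)²| < θ`; (iii) the pointwise Navier–Stokes inequality on
`ℝ³ × [0,T]` for every `ν ∈ [0,ν₀]` with the pressure function of `v^{(j)}`; (iv)
`‖v^{(j)}(t)‖ ≤ 𝒞`, `∫₀ᵀ‖∇v^{(j)}‖² ≤ 𝒞` — where the printed PROOF (§6.3 Step 3, pp. 31–32: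
"`‖v(t)‖_{L²} ≤ 𝔐𝒞`", "`∫₀ᵀ‖∇v(t)‖² dt ≤ 𝔐𝒞`", `𝔐 = Mʲ`) delivers the constant `𝒞·Mʲ`, which
is what p. 30 uses ("it suffices to replace `τ` by `Mτ` … in (2.8)–(2.9)"). By §6.3 Step 1 the
field `v^{(j)}` lives on `𝔐 = Mʲ` pairwise disjoint translates `K^𝔪` of `Ū₁ ∪ Ū₂` in the axial
direction, `U_i^𝔪 = {(x₁,x₂) : (π_m⁻¹(τʲx₁), x₂) ∈ U_i}`, i.e. the translate by
`τ^{-j}π_m(0) = τ^{-j}(z₁(1-τʲ)/(1-τ) + X Σ_k τ^{k-1}(m_k - 1))`. Then (6.13)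
`u^{(j)}(x,t) := τ^{-j} v^{(j)}(τ^{-j}x₁, γ^{-j}(x₂), τ^{-j}x₃, τ^{-2j}(t - t_j))` on `[t_j,t_{j+1}]`,
and the text derives (6.14) `supp u^{(j)}(t) = ⋃_{m∈M(j)} Γ_m(G)`, (6.15) the NSI, the identities
`|u^{(j)}(Γ_m y, t_j)| = τ^{-j}h₀(R⁻¹y)`, `|u^{(j)}(x,t_{j+1})|² > τ^{-2j}(h_T² - θ)`, whence the
drop (6.16) `|u^{(j)}(x,t_j)| ≤ |u^{(j-1)}(x,t_j)|` (using (6.12) and the disjointness (6.3)),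
the uniform growth, and the bounds `sup‖u^{(j)}‖ < ∞`, `Σ_j ∫‖∇u^{(j)}‖² < ∞` (p. 30).

## Rendering (this file)

Dictionary as in `NavierStokesInequalityArrangement`: the symmetry axis is `x 2` (Ożański's
`Ox₁`), plane points are `q = (r, z)`, `R⁻¹ = meridian`, `R(U) = revolve U`, his plane
`{x₃ = 0}` is `{x 1 = 0}`; so his `(X,0,0)` is `X • EuclideanSpace.single 2 1` (`= X • eZ`) and
his `z = (z₁,z₂,0)` reads `z 1 = 0`. The similarities are indexed by `n : Fin M` (printed
`n-1 ∈ {0,…,M-1}`): `Γ_n(x) = τx + cantorTranslate X z M n`,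
`cantorTranslate X z M n = z + (nX) • EuclideanSpace.single 2 1` — literally the translation
family of fact B′; words `m : Fin j → Fin M` and `Γ_m = CantorDust.word τ (cantorTranslate X z M) m`.

* `IsNSICantorArrangement U₁ U₂ v₁ f₁ φ₁ v₂ f₂ φ₂ T τ M X z` — the printed definition with the
  `ξ`-free half of (6.2) (`τM < 1`); the `ξ`-dependent half `τ^ξ M ≥ 1` is carried by fact C′
  (exactly as fact B′ carries it outside `IsNSICantorBlock`). Of (6.3) only the pairwise
  disjointness is a field: `Γ_n(G) ⊆ G₂ = R(Ū₂)` FOLLOWS from (6.7) (`mapsTo_revolve_closure`, as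
  in the one-point file). `U₁ ≠ ∅` and `M ≥ 1` are explicit (tacit in print: `U₁ ⊇ U`,
  `M = 1 + d/(4X)`; they exclude the vacuous empty arrangement, which carries no block).
* Fact C′ `NSICantorArrangementExists` — §6.5: for every `ξ ∈ (0,1)` an arrangement with
  `τ^ξ M ≥ 1`.
* `levelCenter τ z j = (Σ_{k<j} τᵏ) • (z - (z 2) • eZ)` (the transverse part of `Γ_m(0)`, the same
  for all words `m` of length `j`) and `levelShift τ X z m = τ^{-j} Σ_{k<j} τᵏ (z 2 + m_k X)` (the
  axial position of the `m`-th translate `K^𝔪`): `Γ_m(y) = levelCenter + τʲ(y + levelShift • eZ)`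
  (`word_cantorTranslate_eq`), i.e. the un-rescaling `x ↦ τ^{-j}(x - levelCenter)` of (6.13) maps
  `Γ_m(G)` onto the translate `G + levelShift • eZ`.
* `IsNSICantorLevelFields U₁ U₂ f₁ f₂ T τ M X z θ ν₀ h V` — the LEVEL DATA of §6.2: `θ > 0`,
  `ν₀ > 0`, the profile `h : ℝ → ℝ × ℝ → ℝ` (`h 0 = f₁ + f₂`, the gain (6.12) at `t = T`), and the
  fields `V j = v^{(j)}` (time first) with Prop. 16 (i)–(iv), (ii) written translate-by-translate
  (`y ∈ G`, `m : Fin j → Fin M`, at the point `y + levelShift • eZ`), (iv) with the constant `𝒞 Mʲ`.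
* Fact D′ `NSICantorBlock_of_arrangement` — RESTATED (review of the decomposition, D-0026,
  2026-08-15; the decl name is kept for the ledger): every arrangement carries level data
  `IsNSICantorLevelFields` ((6.8)–(6.12) "as in Lemma 4.1", Prop. 16 with §6.3–§6.4, Thm. 17).
  Its former statement ("every arrangement carries a Cantor block") is now the PROVED corollary
  `isNSICantorBlock_of_nsiCantorBlock_of_arrangement`.
* `cantorPiece T τ z V j = u^{(j)}` — the rescaled piece (6.13), as the affine pull-back
  `τ^{-j} • stPull τ^{-2j} τ^{-j} (-τ^{-2j}t_j) (-τ^{-j} levelCenter) (V j)`.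
* PROVED: `Γ_n(G) ⊆ R(Ū₂) ⊆ G`, `G` compact and nonempty, a point of `G` with `f₁ + f₂ > 0`,
  the specialisation `IsNSICantorArrangement → IsNSIArrangement` at `n = 1` ("the previous
  geometric arrangement is recovered"); **the block from the level data**
  `IsNSICantorArrangement.isNSICantorBlock_of_levelFields` — (6.14) (supports on the generations
  `CantorDust.level`), (6.15) (scale covariance of `∂ₜ|u|²`, `∇(|u|² + 2p̃)`, `Δu`, `div`), the drop
  (6.16), the growth (6.17) at the point of `exists_add_pos`, and the p. 30 bounds
  (`∫|u^{(j)}(t)|² = τʲ∫|v^{(j)}|² ≤ (τM)ʲ𝒞`, `Σ_j τʲ∫∫|∇v^{(j)}|² ≤ Σ_j (τM)ʲ𝒞 < ∞`); and the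
  assembly `nsiCantorBlockExists_of_arrangement : C′ → D′ → B′`.

Deliberately NOT here: the proofs of C′ (§6.5 on top of §5: Theorem 3.4, Lemma 3.5, Lemmas
5.2–5.3, Lemma 18) and of D′ ((6.8)–(6.12), Prop. 16, Thm. 17 — the `𝔐`-pair version of the
one-point facts D-II/D-I of `NavierStokesInequalityProfiles`, whose `j = 0` case they are).

## References

* W. S. Ożański, arXiv:1709.00602v4 (2017/2019), §6.2 (the geometric arrangement for Thm. 14,
  (6.6)–(6.12), Prop. 16, (6.13)–(6.18), p. 30), §6.3 (Steps 1–3), §6.4 (Thm. 17), §6.5 (Steps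
  1–5, Lemma 18, (6.33)–(6.36)). [`Ozanski2017NSISingular`]
* V. Scheffer, Comm. Math. Phys. 110 (1987), 525–551: §3 (Lemmas 3.1–3.2), §4 (Lemmas 4.1–4.18,
  (4.8), (4.32)–(4.33)), §5 (Lemmas 5.1–5.8, (5.19)–(5.38)). [`Scheffer1987`]
* V. Scheffer, Comm. Math. Phys. 101 (1985), 47–85, §3–§4. [`Scheffer1985`]
-/

noncomputable section

open MeasureTheory Set Function Filter Topology TopologicalSpace WithLp Metric
open Literature.MeasureTheory.Hausdorff
open scoped ENNReal NNReal InnerProductSpace RealInnerProductSpace ContDiff Laplacian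

namespace Literature.Barriers.NavierStokesRegularity

open Literature.Analysis.FluidPDE

/-- Local notation for physical space `ℝ³ = EuclideanSpace ℝ (Fin 3)`. -/
local notation "ℝ³" => EuclideanSpace ℝ (Fin 3)

/-! ### The similarity data of the Cantor construction -/

/-- **The translations of the Cantor similarities** `Γ_n(x) = τx + z + (n-1)(X,0,0)`,
`n = 1,…,M` (Ożański 2017, §6.1, before (6.4); Scheffer 1987, (5.19): `β_n(x) = τx + A + nX`,
`n = 0,…,Y`), indexed by `n : Fin M` and written in the tree's axisymmetric coordinates (axis
`x 2`): `cantorTranslate X z M n = z + (nX) • EuclideanSpace.single 2 1` — the translation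
family of `NSICantorBlockExists`. [cite: Ozanski2017NSISingular, §6.1] -/
def cantorTranslate (X : ℝ) (z : ℝ³) (M : ℕ) : Fin M → ℝ³ :=
  fun n => z + (((n : ℕ) : ℝ) * X) • EuclideanSpace.single 2 1

/-- Unfolding `cantorTranslate`. [folklore] -/
@[simp] theorem cantorTranslate_apply (X : ℝ) (z : ℝ³) (M : ℕ) (n : Fin M) :
    cantorTranslate X z M n = z + (((n : ℕ) : ℝ) * X) • EuclideanSpace.single 2 1 := rfl

/-- The first similarity is `Γ_1(x) = τx + z` (the similarity `Γ` of the one-point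
arrangement, Ożański (4.3)). [cite: Ozanski2017NSISingular, §6.2 p. 28] -/
theorem cantorTranslate_zero (X : ℝ) (z : ℝ³) {M : ℕ} (hM : 0 < M) :
    cantorTranslate X z M ⟨0, hM⟩ = z := by
  simp [cantorTranslate]

/-! ### The geometric arrangement for Theorem 14 (Ożański 2017, §6.2) -/

/-- **The geometric arrangement for the Cantor-set blow-up** (Ożański 2017, §6.2, p. 28, verbatim
up to the placement of (6.2); Scheffer 1987, §4 with (5.1)–(5.7), (5.19)–(5.25)): open sets
`U₁, U₂ ⋐ P` with structures `(v₁,f₁,φ₁)`, `(v₂,f₂,φ₂)` (`IsNSIStructure`, Ożański's Def. 3.3)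
and disjoint closures, numbers `T > 0`, `X > 0`, `τ ∈ (0,1)`, `M ∈ ℕ` (`M ≥ 1`), a point `z` with
`z = (z₁,z₂,0)` (here: `z 1 = 0`), such that, with `G := R(Ū₁ ∪ Ū₂)`,
`Γ_n(x) = τx + cantorTranslate X z M n` and `F = F[v₁,f₁]` (`pressureInteraction v₁ f₁`):
* (6.2), `ξ`-free half: `τM < 1` (the half `τ^ξ M ≥ 1` is carried by `NSICantorArrangementExists`);
* (6.3): the sets `Γ_n(G)`, `n : Fin M`, are pairwise disjoint (that they lie in `G₂ = R(Ū₂)` is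
  a consequence of (6.7), `IsNSICantorArrangement.mapsTo_revolve_closure`);
* (6.6): `f₂² + T v₂·F > |v₂|²` in `U₂`;
* (6.7): `f₂(y_n)² + T v₂(y_n)·F(y_n) > τ⁻²(f₁(R⁻¹x) + f₂(R⁻¹x))²` for all `x ∈ G`, `n : Fin M`,
  `y_n = R⁻¹(Γ_n x)`;
and `U₁ ≠ ∅` (tacit in print: `U₁ ⊇ ⋃ₙ U^{nX}`, §6.5 Step 4). Planar inner products are written
out (`ℝ × ℝ` carries the sup norm).
[cite: Ozanski2017NSISingular, §6.2 (6.2)–(6.3), (6.6)–(6.7)] [cite: Scheffer1987, §4 and (5.1)–(5.7), (5.19)–(5.25)] -/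
structure IsNSICantorArrangement (U₁ U₂ : Set (ℝ × ℝ)) (v₁ : ℝ × ℝ → ℝ × ℝ) (f₁ φ₁ : ℝ × ℝ → ℝ)
    (v₂ : ℝ × ℝ → ℝ × ℝ) (f₂ φ₂ : ℝ × ℝ → ℝ) (T τ : ℝ) (M : ℕ) (X : ℝ) (z : ℝ³) : Prop where
  /-- `(v₁, f₁, φ₁)` is a structure on `U₁`. -/
  structure₁ : IsNSIStructure U₁ v₁ f₁ φ₁
  /-- `(v₂, f₂, φ₂)` is a structure on `U₂`. -/
  structure₂ : IsNSIStructure U₂ v₂ f₂ φ₂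
  /-- `Ū₁ ∩ Ū₂ = ∅`. -/
  disjoint_closure : Disjoint (closure U₁) (closure U₂)
  /-- `U₁ ≠ ∅` (tacit in print). -/
  nonempty : U₁.Nonempty
  /-- `T > 0`. -/
  T_pos : 0 < T
  /-- `0 < τ < 1`. -/
  τ_mem : τ ∈ Ioo (0 : ℝ) 1
  /-- `M ≥ 1` (printed: `M = 1 + d/(4X)` a positive integer, (6.35)). -/
  M_pos : 0 < M
  /-- `X > 0`. -/
  X_pos : 0 < X
  /-- `z = (z₁, z₂, 0)` lies in the meridian plane `{x 1 = 0}` (printed `{x₃ = 0}`). -/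
  z_apply_one : z 1 = 0
  /-- (6.2), the `ξ`-free half: `τM < 1`. -/
  τ_mul_lt_one : τ * M < 1
  /-- (6.3): the images `Γ_n(G)`, `G = R(Ū₁ ∪ Ū₂)`, are pairwise disjoint. -/
  disjoint_image : Pairwise fun n n' : Fin M =>
    Disjoint ((fun x : ℝ³ => τ • x + cantorTranslate X z M n) '' revolve (closure U₁ ∪ closure U₂))
      ((fun x : ℝ³ => τ • x + cantorTranslate X z M n') '' revolve (closure U₁ ∪ closure U₂))
  /-- (6.6): `f₂² + T v₂·F[v₁,f₁] > |v₂|²` in `U₂`. -/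
  sq_lt : ∀ q ∈ U₂, (v₂ q).1 ^ 2 + (v₂ q).2 ^ 2 <
    f₂ q ^ 2 + T * ((v₂ q).1 * (pressureInteraction v₁ f₁ q).1 +
      (v₂ q).2 * (pressureInteraction v₁ f₁ q).2)
  /-- (6.7): `f₂(y_n)² + T v₂(y_n)·F[v₁,f₁](y_n) > τ⁻²(f₁(R⁻¹x) + f₂(R⁻¹x))²` for `x ∈ G`,
  `n : Fin M`, `y_n = R⁻¹(τx + cantorTranslate X z M n)`. -/
  gain : ∀ x ∈ revolve (closure U₁ ∪ closure U₂), ∀ n : Fin M,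
    τ⁻¹ ^ 2 * (f₁ (meridian x) + f₂ (meridian x)) ^ 2 <
      f₂ (meridian (τ • x + cantorTranslate X z M n)) ^ 2 +
        T * ((v₂ (meridian (τ • x + cantorTranslate X z M n))).1 *
              (pressureInteraction v₁ f₁ (meridian (τ • x + cantorTranslate X z M n))).1 +
          (v₂ (meridian (τ • x + cantorTranslate X z M n))).2 *
              (pressureInteraction v₁ f₁ (meridian (τ • x + cantorTranslate X z M n))).2)

namespace IsNSICantorArrangement

variable {U₁ U₂ : Set (ℝ × ℝ)} {v₁ : ℝ × ℝ → ℝ × ℝ} {f₁ φ₁ : ℝ × ℝ → ℝ} {v₂ : ℝ × ℝ → ℝ × ℝ}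
  {f₂ φ₂ : ℝ × ℝ → ℝ} {T τ : ℝ} {M : ℕ} {X : ℝ} {z : ℝ³}

/-- `0 < τ`. [folklore] -/
theorem τ_pos (h : IsNSICantorArrangement U₁ U₂ v₁ f₁ φ₁ v₂ f₂ φ₂ T τ M X z) : 0 < τ :=
  h.τ_mem.1

/-- `τ < 1`. [folklore] -/
theorem τ_lt_one (h : IsNSICantorArrangement U₁ U₂ v₁ f₁ φ₁ v₂ f₂ φ₂ T τ M X z) : τ < 1 :=
  h.τ_mem.2

/-- The set `G = R(Ū₁ ∪ Ū₂)` of the arrangement is compact.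
[cite: Ozanski2017NSISingular, §6.1 ("Let `G ⊂ ℝ³` be a compact set … `G := R(Ū₁ ∪ Ū₂)`")] -/
theorem isCompact_revolve (h : IsNSICantorArrangement U₁ U₂ v₁ f₁ φ₁ v₂ f₂ φ₂ T τ M X z) :
    IsCompact (revolve (closure U₁ ∪ closure U₂)) :=
  Literature.Barriers.NavierStokesRegularity.isCompact_revolve
    (h.structure₁.isCompact_closure.union h.structure₂.isCompact_closure)

/-- **`Γ_n(G) ⊆ G₂ = R(Ū₂)`** (the inclusion half of Ożański's (6.3)), from (6.7) alone: at
`y_n = R⁻¹(Γ_n x)`, `x ∈ G`, the right-hand side of (6.7) is positive, so `f₂(y_n) ≠ 0` or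
`v₂(y_n) ≠ 0`, whence `y_n ∈ Ū₂` (cf. §6.5 Step 5: "`Γ_m(G) ⊂ R(RECT) ⊂ R(Ū₂) = G₂`").
[cite: Ozanski2017NSISingular, §6.2 (6.3) and §6.5 Step 5] -/
theorem mapsTo_revolve_closure (h : IsNSICantorArrangement U₁ U₂ v₁ f₁ φ₁ v₂ f₂ φ₂ T τ M X z)
    (n : Fin M) :
    MapsTo (fun x : ℝ³ => τ • x + cantorTranslate X z M n) (revolve (closure U₁ ∪ closure U₂))
      (revolve (closure U₂)) := by
  intro x hx
  have hg := h.gain x hx n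
  simp only [mem_revolve]
  by_contra hy
  have hf : f₂ (meridian (τ • x + cantorTranslate X z M n)) = 0 := h.structure₂.f_eq_zero hy
  have hv : v₂ (meridian (τ • x + cantorTranslate X z M n)) = 0 := h.structure₂.v_eq_zero hy
  rw [hf, hv] at hg
  simp only [Prod.fst_zero, Prod.snd_zero, zero_mul, add_zero, mul_zero, ne_eq,
    OfNat.ofNat_ne_zero, not_false_eq_true, zero_pow] at hg
  exact absurd hg (not_lt.2 (by positivity))

/-- **Each `Γ_n` maps `G` into itself** (Ożański (6.3) with `G₂ ⊆ G`; Scheffer 1987, (5.24):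
`β_j(Q) ⊆ Q`). [cite: Ozanski2017NSISingular, §6.2 (6.3)] -/
theorem mapsTo (h : IsNSICantorArrangement U₁ U₂ v₁ f₁ φ₁ v₂ f₂ φ₂ T τ M X z) (n : Fin M) :
    MapsTo (fun x : ℝ³ => τ • x + cantorTranslate X z M n) (revolve (closure U₁ ∪ closure U₂))
      (revolve (closure U₁ ∪ closure U₂)) :=
  (h.mapsTo_revolve_closure n).mono_right (preimage_mono subset_union_right)

/-- `G ≠ ∅`: the meridian points `(r, 0, z)`, `(r, z) ∈ U₁`, lie in `G`. [folklore] -/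
theorem nonempty_revolve (h : IsNSICantorArrangement U₁ U₂ v₁ f₁ φ₁ v₂ f₂ φ₂ T τ M X z) :
    (revolve (closure U₁ ∪ closure U₂)).Nonempty :=
  let ⟨q, hq⟩ := h.nonempty
  ⟨meridianPoint q, (mem_revolve.2 <| (meridian_meridianPoint
    (le_of_lt (h.structure₁.subset_halfPlane hq))).symm ▸ Or.inl (subset_closure hq))⟩

/-- There is a point of `G` where `f₁ + f₂ > 0` (namely `(r,0,z)` for any `(r,z) ∈ U₁`, where
`f₁ > |v₁| ≥ 0`); this is the point "`y ∈ G` such that `h₀(R⁻¹(y)) > 0`" of Ożański's p. 30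
(`h₀ = f₁ + f₂`). [cite: Ozanski2017NSISingular, §6.2 p. 30] -/
theorem exists_add_pos (h : IsNSICantorArrangement U₁ U₂ v₁ f₁ φ₁ v₂ f₂ φ₂ T τ M X z) :
    ∃ y ∈ revolve (closure U₁ ∪ closure U₂), 0 < f₁ (meridian y) + f₂ (meridian y) := by
  obtain ⟨q, hq⟩ := h.nonempty
  have hm : meridian (meridianPoint q) = q :=
    meridian_meridianPoint (le_of_lt (h.structure₁.subset_halfPlane hq))
  refine ⟨meridianPoint q, mem_revolve.2 (hm.symm ▸ Or.inl (subset_closure hq)), ?_⟩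
  rw [hm]
  have h1 : 0 < f₁ q := by
    have hsq := h.structure₁.sq_lt q hq
    have hf := h.structure₁.f_nonneg q
    rcases hf.lt_or_eq with hlt | heq
    · exact hlt
    · rw [← heq] at hsq
      nlinarith [sq_nonneg (v₁ q).1, sq_nonneg (v₁ q).2]
  linarith [h.structure₂.f_nonneg q]

/-- **"The previous geometric arrangement is recovered"** (Ożański 2017, §6.2, p. 28: "if one
takes `ξ = 0`, `M = 1`"): forgetting all similarities but `Γ_1(x) = τx + z`, a geometric
arrangement for Theorem 14 is a geometric arrangement for Theorem 1 (`IsNSIArrangement`, Ożański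
(4.1)–(4.3)). [cite: Ozanski2017NSISingular, §6.2 p. 28] -/
theorem isNSIArrangement (h : IsNSICantorArrangement U₁ U₂ v₁ f₁ φ₁ v₂ f₂ φ₂ T τ M X z) :
    IsNSIArrangement U₁ U₂ v₁ f₁ φ₁ v₂ f₂ φ₂ T τ z where
  structure₁ := h.structure₁
  structure₂ := h.structure₂
  disjoint := h.disjoint_closure
  nonempty := h.nonempty
  T_pos := h.T_pos
  τ_mem := h.τ_mem
  sq_lt := h.sq_lt
  gain x hx := by
    have hg := h.gain x hx ⟨0, h.M_pos⟩
    rwa [cantorTranslate_zero] at hg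

end IsNSICantorArrangement
/-! ### The unrescaled generation-`j` configuration (Ożański 2017, §6.3 Step 1, and (6.13)) -/

/-- **The transverse centre of generation `j`**: `c_j = (Σ_{k<j} τᵏ) • (z - (z 2) • eZ)`, the
part of `Γ_m(0) = Σ_{k<j} τᵏ(z + m_k X eZ)` orthogonal to the axis — the same for every word `m`
of length `j` (in Ożański's coordinates `(0, γʲ(0), 0) = (0, z₂(1-τʲ)/(1-τ), 0)`, the centre of the
transverse similarity `γʲ` un-done by `γ^{-j}` in (6.13)). [cite: Ozanski2017NSISingular, §6.1 (γ) and §6.2 (6.13)] -/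
def levelCenter (τ : ℝ) (z : ℝ³) (j : ℕ) : ℝ³ :=
  (∑ k : Fin j, τ ^ (k : ℕ)) • (z - z 2 • EuclideanSpace.single 2 1)

/-- **The axial position of the `m`-th translate of generation `j`**:
`levelShift τ X z m = τ^{-j} Σ_{k<j} τᵏ (z 2 + m_k X)` — Ożański's `τ^{-j}π_m(0) =
τ^{-j}(z₁(1-τʲ)/(1-τ) + X Σ_{k=1}^{j} τ^{k-1}(m_k - 1))` (§6.3 Step 1: `U_i^𝔪 = {(x₁,x₂) :
(π_m⁻¹(τʲx₁), x₂) ∈ U_i}` is `U_i` translated by this amount along the axis; 0-based letters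
`m_k ∈ Fin M` here). [cite: Ozanski2017NSISingular, §6.1 (π_m) and §6.3 Step 1] -/
def levelShift (τ X : ℝ) (z : ℝ³) {M j : ℕ} (m : Fin j → Fin M) : ℝ :=
  (τ⁻¹) ^ j * ∑ k : Fin j, τ ^ (k : ℕ) * (z 2 + ((m k : ℕ) : ℝ) * X)

/-- **`Γ_m(y) = c_j + τʲ(y + levelShift • eZ)`**: the composite similarity of the word `m` is the
un-rescaling of (6.13) read backwards — in Ożański's coordinates
`Γ_m(x₁,x₂,x₃) = (π_m(x₁), γʲ(x₂), τʲx₃)` (§6.1) with `π_m(x₁) = τʲ(x₁ + τ^{-j}π_m(0))`,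
`γʲ(x₂) = γʲ(0) + τʲx₂`. [cite: Ozanski2017NSISingular, §6.1 (Γ_m) and §6.2 (6.13)] -/
theorem word_cantorTranslate_eq {τ : ℝ} (hτ : τ ≠ 0) (X : ℝ) (z : ℝ³) {M j : ℕ}
    (m : Fin j → Fin M) (y : ℝ³) :
    CantorDust.word τ (cantorTranslate X z M) m y =
      levelCenter τ z j + τ ^ j • (y + levelShift τ X z m • EuclideanSpace.single 2 1) := by
  have h1 : CantorDust.word τ (cantorTranslate X z M) m y =
      τ ^ j • y + (∑ k : Fin j, τ ^ (k : ℕ)) • z +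
        (∑ k : Fin j, τ ^ (k : ℕ) * (((m k : ℕ) : ℝ) * X)) • EuclideanSpace.single 2 1 := by
    simp only [CantorDust.word, cantorTranslate_apply, smul_add, smul_smul, Finset.sum_add_distrib,
      Finset.sum_smul, add_assoc]
  have h2 : τ ^ j • (y + levelShift τ X z m • EuclideanSpace.single 2 1) =
      τ ^ j • y + (∑ k : Fin j, τ ^ (k : ℕ) * (z 2 + ((m k : ℕ) : ℝ) * X)) •
        EuclideanSpace.single 2 1 := by
    rw [smul_add, smul_smul, levelShift, ← mul_assoc, inv_pow, mul_inv_cancel₀ (pow_ne_zero j hτ),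
      one_mul]
  have h3 : ∑ k : Fin j, τ ^ (k : ℕ) * (z 2 + ((m k : ℕ) : ℝ) * X) =
      (∑ k : Fin j, τ ^ (k : ℕ)) * z 2 + ∑ k : Fin j, τ ^ (k : ℕ) * (((m k : ℕ) : ℝ) * X) := by
    rw [Finset.sum_mul, ← Finset.sum_add_distrib]
    exact Finset.sum_congr rfl fun k _ => by ring
  rw [h1, h2, h3, levelCenter, add_smul, smul_sub, smul_smul]
  abel

/-- The un-rescaling `x ↦ τ^{-j}(x - c_j)` of (6.13) sends `Γ_m(y)` to the translate point
`y + levelShift • eZ`. [cite: Ozanski2017NSISingular, §6.2 (6.13)] -/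
theorem inv_pow_smul_word_sub_levelCenter {τ : ℝ} (hτ : τ ≠ 0) (X : ℝ) (z : ℝ³) {M j : ℕ}
    (m : Fin j → Fin M) (y : ℝ³) :
    (τ⁻¹) ^ j • (CantorDust.word τ (cantorTranslate X z M) m y - levelCenter τ z j) =
      y + levelShift τ X z m • EuclideanSpace.single 2 1 := by
  rw [word_cantorTranslate_eq hτ, add_sub_cancel_left, smul_smul, ← mul_pow,
    inv_mul_cancel₀ hτ, one_pow, one_smul]

/-- Conversely, `τ^{-j}(x - c_j) = y + levelShift • eZ` forces `x = Γ_m(y)`. [folklore] -/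
theorem eq_word_of_inv_pow_smul_sub_eq {τ : ℝ} (hτ : τ ≠ 0) {X : ℝ} {z : ℝ³} {M j : ℕ}
    {m : Fin j → Fin M} {x y : ℝ³}
    (hx : (τ⁻¹) ^ j • (x - levelCenter τ z j) = y + levelShift τ X z m • EuclideanSpace.single 2 1) :
    x = CantorDust.word τ (cantorTranslate X z M) m y := by
  have h1 : τ ^ j • ((τ⁻¹) ^ j • (x - levelCenter τ z j)) = x - levelCenter τ z j := by
    rw [smul_smul, ← mul_pow, mul_inv_cancel₀ hτ, one_pow, one_smul]
  rw [word_cantorTranslate_eq hτ, ← hx, h1, add_sub_cancel]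

/-- Splitting off the LAST letter of a word: `Γ_{(m̄, n)}(y) = Γ_{m̄}(Γ_n(y))`, `m̄ = init m`,
`n = m(last)` (Ożański p. 29: "`x = Γ_{m̄}(Γ_{m_j}(y))`"). [cite: Ozanski2017NSISingular, §6.2 p. 29] -/
theorem word_eq_word_init {E : Type*} [NormedAddCommGroup E] [NormedSpace ℝ E] (τ : ℝ) {M j : ℕ}
    (d : Fin M → E) (m : Fin (j + 1) → Fin M) (y : E) :
    CantorDust.word τ d m y = CantorDust.word τ d (Fin.init m) (τ • y + d (m (Fin.last j))) := by
  simp only [CantorDust.word, Fin.sum_univ_castSucc, Fin.val_castSucc, Fin.val_last, smul_add,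
    smul_smul, pow_succ, Fin.init]
  abel

/-! ### The level data of an arrangement (Ożański 2017, §6.2 (6.8)–(6.12) and Proposition 16) -/

/-- **Level data for the Cantor block** (Ożański 2017, §6.2, pp. 28–29: the number `θ > 0` of
(6.8), the profile `h_t = h_{1,t} + h_{2,t}` of (6.9)–(6.11) with `h₀ = f₁ + f₂` and the gain
(6.12) `h²_{2,T}(y_n) > τ⁻²(f₁(R⁻¹x) + f₂(R⁻¹x))² + θ` (`x ∈ G`, `y_n = R⁻¹(Γ_n x)`, where
`h_{1,T}(y_n) = 0`, so `h_T(y_n)² = h_{2,T}(y_n)²`), `ν₀ > 0` of (4.13), and the fields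
`V j = v^{(j)} ∈ C^∞(ℝ³ × [0,T]; ℝ³)` of **Proposition 16** (time first), `j ≥ 0`, living on the
`Mʲ` axial translates `G + levelShift τ X z m • eZ`, `m : Fin j → Fin M`, of `G = R(Ū₁ ∪ Ū₂)`
(§6.3 Step 1): (i) `div V j(s) = 0` and `supp V j(s) ⊆ ⋃_m (G + levelShift • eZ)`
(printed `= R(supp h_s^{(j)})`) for `s ∈ [0,T]`; (ii) on each translate,
`|V j(0, y + levelShift • eZ)| = h₀(R⁻¹y)` and `||V j(s, y + levelShift • eZ)|² - h_s(R⁻¹y)²| < θ`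
(`y ∈ G`, `s ∈ [0,T]`; printed `|v^{(j)}(x,0)| = h₀^{(j)}(R⁻¹x)`,
`||v^{(j)}(x,t)|² - h_t^{(j)}(R⁻¹x)²| < θ`, `h_t^{(j)} = Σ_m h_t(π_m⁻¹(τʲ·),·)`, the translates
being pairwise disjoint); (iii) the pointwise Navier–Stokes inequality
`∂ₜ|V|² ≤ -V·∇(|V|² + 2p̃[V(s)]) + 2ν V·ΔV` on `[0,T] × ℝ³` for every `ν ∈ [0,ν₀]`, with the
pressure function `p̃ = normalisedPressure` (Ożański's (1.1)); (iv) `sup_{s∈[0,T]} ∫|V j(s)|² ≤ 𝒞Mʲ`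
and `∫₀ᵀ∫|∇V j|² ≤ 𝒞Mʲ` — the constant delivered by the printed proof (§6.3 Step 3, pp. 31–32:
`|v| ≤ 𝒞` pointwise on `Mʲ` copies of `G`, "`‖v(t)‖_{L²} ≤ 𝔐𝒞`", "`∫₀ᵀ‖∇v‖² ≤ 𝔐𝒞`",
`𝔐 = Mʲ`; the statement of Prop. 16 (iv) prints `𝒞` alone, p. 30 uses `Mʲ`: "replace `τ` by
`Mτ`"). Scheffer 1987: Lemma 5.5 (the fields `v^Z`) with Lemmas 5.6–5.8.
[cite: Ozanski2017NSISingular, §6.2 (6.8)–(6.12) and Prop. 16 (i)–(iv); §6.3 Steps 1, 3]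
[cite: Scheffer1987, Lemma 5.5] -/
structure IsNSICantorLevelFields (U₁ U₂ : Set (ℝ × ℝ)) (f₁ f₂ : ℝ × ℝ → ℝ) (T τ : ℝ) (M : ℕ)
    (X : ℝ) (z : ℝ³) (θ ν₀ : ℝ) (h : ℝ → ℝ × ℝ → ℝ) (V : ℕ → ℝ → ℝ³ → ℝ³) : Prop where
  /-- (6.8): `θ > 0`. -/
  θ_pos : 0 < θ
  /-- (4.13): `ν₀ > 0`. -/
  ν₀_pos : 0 < ν₀
  /-- `h₀ = f₁ + f₂` ((6.10)–(6.11) at `t = 0`, `h ≥ 0`). -/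
  h_zero : ∀ q, h 0 q = f₁ q + f₂ q
  /-- (6.12): `h_T(R⁻¹(Γ_n x))² > τ⁻² h₀(R⁻¹x)² + θ` for `x ∈ G`, `n : Fin M`. -/
  gain : ∀ x ∈ revolve (closure U₁ ∪ closure U₂), ∀ n : Fin M,
    τ⁻¹ ^ 2 * h 0 (meridian x) ^ 2 + θ < h T (meridian (τ • x + cantorTranslate X z M n)) ^ 2
  /-- `v^{(j)} ∈ C^∞(ℝ³ × [0,T])`: jointly smooth on `(-η, T+η) × ℝ³` for some `η > 0`. -/
  smooth : ∀ j : ℕ, ∃ η : ℝ, 0 < η ∧ IsSmoothSpaceTimeOn (Ioo (-η) (T + η)) (V j)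
  /-- (i): `div v^{(j)}(s) = 0`, `s ∈ [0,T]`. -/
  divFree : ∀ j : ℕ, ∀ s ∈ Icc (0 : ℝ) T, VectorCalculus.IsDivFree (V j s)
  /-- (i): `supp v^{(j)}(s) ⊆ ⋃_m (G + levelShift • eZ)`, `s ∈ [0,T]`. -/
  tsupport_subset : ∀ j : ℕ, ∀ s ∈ Icc (0 : ℝ) T, tsupport (V j s) ⊆
    ⋃ m : Fin j → Fin M, (fun y : ℝ³ => y + levelShift τ X z m • EuclideanSpace.single 2 1) ''
      revolve (closure U₁ ∪ closure U₂)
  /-- (ii): `|v^{(j)}(0, y + levelShift • eZ)| = h₀(R⁻¹y)` for `y ∈ G`. -/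
  norm_zero : ∀ j : ℕ, ∀ y ∈ revolve (closure U₁ ∪ closure U₂), ∀ m : Fin j → Fin M,
    ‖V j 0 (y + levelShift τ X z m • EuclideanSpace.single 2 1)‖ = h 0 (meridian y)
  /-- (ii): `||v^{(j)}(s, y + levelShift • eZ)|² - h_s(R⁻¹y)²| < θ` for `y ∈ G`, `s ∈ [0,T]`. -/
  abs_sq_sub_lt : ∀ j : ℕ, ∀ s ∈ Icc (0 : ℝ) T, ∀ y ∈ revolve (closure U₁ ∪ closure U₂),
    ∀ m : Fin j → Fin M,
    |‖V j s (y + levelShift τ X z m • EuclideanSpace.single 2 1)‖ ^ 2 - h s (meridian y) ^ 2| < θ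
  /-- (iii): the pointwise Navier–Stokes inequality on `[0,T] × ℝ³` for every `ν ∈ [0,ν₀]`. -/
  nsi : ∀ j : ℕ, ∀ ν ∈ Icc (0 : ℝ) ν₀, ∀ s ∈ Icc (0 : ℝ) T, ∀ x : ℝ³,
    timeDeriv (fun r y => ‖V j r y‖ ^ 2) s x ≤
      -⟪V j s x, gradient (fun y => ‖V j s y‖ ^ 2 + 2 * normalisedPressure (V j s) y) x⟫ +
        2 * ν * ⟪V j s x, Δ (V j s) x⟫
  /-- (iv): `sup_{s ∈ [0,T]} ∫ |v^{(j)}(s)|² ≤ 𝒞 Mʲ`. -/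
  energy : ∃ C : ℝ≥0, ∀ j : ℕ, ∀ s ∈ Icc (0 : ℝ) T,
    ∫⁻ x, ‖V j s x‖ₑ ^ 2 ≤ (C : ℝ≥0∞) * (M : ℝ≥0∞) ^ j
  /-- (iv): `∫₀ᵀ ∫ |∇v^{(j)}|² ≤ 𝒞 Mʲ`. -/
  dissipation : ∃ C : ℝ≥0, ∀ j : ℕ,
    (∫⁻ s in Icc (0 : ℝ) T, ∫⁻ x, ENNReal.ofReal (frobeniusNormSq (fderiv ℝ (V j s) x))) ≤
      (C : ℝ≥0∞) * (M : ℝ≥0∞) ^ j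

/-! ### The rescaled pieces (6.13) -/

/-- **The rescaled piece** `u^{(j)}(x,t) = τ^{-j} v^{(j)}(τ^{-j}(x - c_j), τ^{-2j}(t - t_j))`
(Ożański (6.13): `τ^{-j}v^{(j)}(τ^{-j}x₁, γ^{-j}(x₂), τ^{-j}x₃, τ^{-2j}(t - t_j))`, `γ^{-j}(x₂) =
τ^{-j}(x₂ - γʲ(0))`; Scheffer 1987, (5.34)), time first, as the affine pull-back
`τ^{-j} • stPull τ^{-2j} τ^{-j} (-τ^{-2j}t_j) (-τ^{-j}c_j) (V j)`.
[cite: Ozanski2017NSISingular, §6.2 (6.13)] [cite: Scheffer1987, (5.34)] -/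
def cantorPiece (T τ : ℝ) (z : ℝ³) (V : ℕ → ℝ → ℝ³ → ℝ³) (j : ℕ) : ℝ → ℝ³ → ℝ³ :=
  (τ⁻¹) ^ j • stPull ((τ⁻¹) ^ (2 * j)) ((τ⁻¹) ^ j) (-((τ⁻¹) ^ (2 * j) * switchTime T τ j))
    (-((τ⁻¹) ^ j • levelCenter τ z j)) (V j)

/-- Pointwise formula `u^{(j)}(t,x) = τ^{-j} v^{(j)}(τ^{-2j}(t - t_j), τ^{-j}(x - c_j))`.
[cite: Ozanski2017NSISingular, §6.2 (6.13)] -/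
theorem cantorPiece_apply (T τ : ℝ) (z : ℝ³) (V : ℕ → ℝ → ℝ³ → ℝ³) (j : ℕ) (t : ℝ) (x : ℝ³) :
    cantorPiece T τ z V j t x = (τ⁻¹) ^ j •
      V j ((τ⁻¹) ^ (2 * j) * (t - switchTime T τ j)) ((τ⁻¹) ^ j • (x - levelCenter τ z j)) := by
  rw [cantorPiece, smul_stPull_apply]
  congr 2
  · ring
  · rw [smul_sub, neg_add_eq_sub]

/-- The piece along the generation: `u^{(j)}(t, Γ_m y) = τ^{-j} v^{(j)}(τ^{-2j}(t - t_j),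
y + levelShift • eZ)`. [cite: Ozanski2017NSISingular, §6.2 (6.13)–(6.14)] -/
theorem cantorPiece_apply_word {τ : ℝ} (hτ : τ ≠ 0) (T X : ℝ) (z : ℝ³) {M : ℕ}
    (V : ℕ → ℝ → ℝ³ → ℝ³) {j : ℕ} (m : Fin j → Fin M) (t : ℝ) (y : ℝ³) :
    cantorPiece T τ z V j t (CantorDust.word τ (cantorTranslate X z M) m y) = (τ⁻¹) ^ j •
      V j ((τ⁻¹) ^ (2 * j) * (t - switchTime T τ j))
        (y + levelShift τ X z m • EuclideanSpace.single 2 1) := by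
  rw [cantorPiece_apply, inv_pow_smul_word_sub_levelCenter hτ]

/-! ### From level data to the Cantor block: the rescaling (6.13)–(6.17) and the bounds of p. 30 -/

namespace IsNSICantorLevelFields

variable {U₁ U₂ : Set (ℝ × ℝ)} {f₁ f₂ : ℝ × ℝ → ℝ} {T τ : ℝ} {M : ℕ} {X : ℝ} {z : ℝ³} {θ ν₀ : ℝ}
  {h : ℝ → ℝ × ℝ → ℝ} {V : ℕ → ℝ → ℝ³ → ℝ³}

/-- `[0,T] ⊆ (-η, T+η)`. [folklore] -/
theorem Icc_subset_Ioo {η : ℝ} (hη : 0 < η) : Icc (0 : ℝ) T ⊆ Ioo (-η) (T + η) := fun _ hs =>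
  ⟨by linarith [hs.1], by linarith [hs.2]⟩

/-- The slices `v^{(j)}(s)`, `s ∈ [0,T]`, are `C^∞`. [cite: Ozanski2017NSISingular, Prop. 16] -/
theorem contDiff_slice (hL : IsNSICantorLevelFields U₁ U₂ f₁ f₂ T τ M X z θ ν₀ h V) (j : ℕ)
    {s : ℝ} (hs : s ∈ Icc (0 : ℝ) T) : ContDiff ℝ ∞ (V j s) := by
  obtain ⟨η, hη, hsm⟩ := hL.smooth j
  exact hsm.contDiff_slice (Icc_subset_Ioo hη hs)

/-- The union of the `Mʲ` translates of the compact `G` is compact. [folklore] -/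
theorem isCompact_iUnion_translate (hG : IsCompact (revolve (closure U₁ ∪ closure U₂))) (j : ℕ) :
    IsCompact (⋃ m : Fin j → Fin M, (fun y : ℝ³ => y + levelShift τ X z m • EuclideanSpace.single 2 1) ''
      revolve (closure U₁ ∪ closure U₂)) :=
  isCompact_iUnion fun _ => hG.image (continuous_id.add continuous_const)

/-- The slices `v^{(j)}(s)`, `s ∈ [0,T]`, have compact support (they live on `Mʲ` translates of the
compact `G`). [cite: Ozanski2017NSISingular, Prop. 16 (i)] -/
theorem hasCompactSupport_slice (hL : IsNSICantorLevelFields U₁ U₂ f₁ f₂ T τ M X z θ ν₀ h V)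
    (hG : IsCompact (revolve (closure U₁ ∪ closure U₂))) (j : ℕ) {s : ℝ} (hs : s ∈ Icc (0 : ℝ) T) :
    HasCompactSupport (V j s) :=
  (isCompact_iUnion_translate hG j).of_isClosed_subset (isClosed_tsupport _) (hL.tsupport_subset j s hs)

end IsNSICantorLevelFields

/-! #### Scalars and the local time -/

section Scalars

variable {τ : ℝ}

/-- `τ^{-2j} τ^{2j} = 1`. [folklore] -/
theorem inv_pow_mul_pow_two_mul (hτ : τ ≠ 0) (j : ℕ) : (τ⁻¹) ^ (2 * j) * τ ^ (2 * j) = 1 := by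
  rw [inv_pow, inv_mul_cancel₀ (pow_ne_zero _ hτ)]

/-- The local time `τ^{-2j}(t - t_j)` of the `j`-th piece lies in `[0,T]` for `t ∈ [t_j, t_{j+1}]`.
[cite: Ozanski2017NSISingular, §6.2 (6.13)] -/
theorem localTime_mem_Icc' (hτ : 0 < τ) {T : ℝ} {j : ℕ} {t : ℝ}
    (ht : t ∈ Icc (switchTime T τ j) (switchTime T τ (j + 1))) :
    (τ⁻¹) ^ (2 * j) * (t - switchTime T τ j) ∈ Icc 0 T := by
  have hβ : 0 < (τ⁻¹) ^ (2 * j) := pow_pos (inv_pos.2 hτ) _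
  rw [switchTime_succ] at ht
  refine ⟨mul_nonneg hβ.le (by linarith [ht.1]), ?_⟩
  have h1 : t - switchTime T τ j ≤ T * τ ^ (2 * j) := by linarith [ht.2]
  calc (τ⁻¹) ^ (2 * j) * (t - switchTime T τ j) ≤ (τ⁻¹) ^ (2 * j) * (T * τ ^ (2 * j)) :=
        mul_le_mul_of_nonneg_left h1 hβ.le
    _ = T := by rw [mul_comm T, ← mul_assoc, inv_pow_mul_pow_two_mul hτ.ne', one_mul]

/-- The same in the affine form `-τ^{-2j}t_j + τ^{-2j}t` of `stPull`. [folklore] -/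
theorem localTime_mem_Icc'' (hτ : 0 < τ) {T : ℝ} {j : ℕ} {t : ℝ}
    (ht : t ∈ Icc (switchTime T τ j) (switchTime T τ (j + 1))) :
    -((τ⁻¹) ^ (2 * j) * switchTime T τ j) + (τ⁻¹) ^ (2 * j) * t ∈ Icc 0 T := by
  convert localTime_mem_Icc' hτ ht using 1
  ring

/-- At `t = t_{j+1}` the local time of the `j`-th piece is `T`. [folklore] -/
theorem localTime_switchTime_succ (hτ : τ ≠ 0) (T : ℝ) (j : ℕ) :
    (τ⁻¹) ^ (2 * j) * (switchTime T τ (j + 1) - switchTime T τ j) = T := by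
  rw [switchTime_succ, add_sub_cancel_left, mul_comm T, ← mul_assoc, inv_pow_mul_pow_two_mul hτ,
    one_mul]

/-- `‖α‖ₑ² (α³)⁻¹ = α⁻¹` in `ℝ≥0∞` (`α > 0`): the Jacobian bookkeeping of `∫|τ^{-j}v(τ^{-j}·)|²`.
[folklore] -/
theorem enorm_sq_mul_ofReal_inv_pow_three {α : ℝ} (hα : 0 < α) :
    ‖α‖ₑ ^ 2 * ENNReal.ofReal (α ^ 3)⁻¹ = ENNReal.ofReal α⁻¹ := by
  rw [Real.enorm_eq_ofReal hα.le, ← ENNReal.ofReal_pow hα.le, ← ENNReal.ofReal_mul (by positivity)]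
  congr 1
  field_simp

/-- `(τM)ʲ ≤ 1` absorbs the factor `Mʲ`: `τʲ (C Mʲ) ≤ C` for `τM < 1` (p. 30: "replace `τ` by
`Mτ`"). [cite: Ozanski2017NSISingular, §6.2 p. 30] -/
theorem ofReal_pow_mul_le (hτ : 0 < τ) {M : ℕ} (hτM : τ * M < 1) (C : ℝ≥0∞) (j : ℕ) :
    ENNReal.ofReal (τ ^ j) * (C * (M : ℝ≥0∞) ^ j) ≤ C := by
  have h1 : ENNReal.ofReal (τ ^ j) * (M : ℝ≥0∞) ^ j ≤ 1 := by
    rw [← ENNReal.ofReal_natCast, ← ENNReal.ofReal_pow (Nat.cast_nonneg _),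
      ← ENNReal.ofReal_mul (pow_nonneg hτ.le _), ← mul_pow, ← ENNReal.ofReal_one]
    exact ENNReal.ofReal_le_ofReal (pow_le_one₀ (by positivity) hτM.le)
  calc ENNReal.ofReal (τ ^ j) * (C * (M : ℝ≥0∞) ^ j)
        = C * (ENNReal.ofReal (τ ^ j) * (M : ℝ≥0∞) ^ j) := by ring
    _ ≤ C * 1 := by gcongr
    _ = C := mul_one C

/-- `ofReal (τʲ) Mʲ = ofReal (τM)ʲ`. [folklore] -/
theorem ofReal_pow_mul_natCast_pow (hτ : 0 < τ) (M j : ℕ) :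
    ENNReal.ofReal (τ ^ j) * (M : ℝ≥0∞) ^ j = ENNReal.ofReal (τ * M) ^ j := by
  rw [← ENNReal.ofReal_natCast, ← ENNReal.ofReal_pow (Nat.cast_nonneg _),
    ← ENNReal.ofReal_mul (pow_nonneg hτ.le _), ← mul_pow, ENNReal.ofReal_pow (by positivity)]

/-- **Time change of variables over one life span**:
`∫⁻_{[t_j, t_{j+1}]} g(τ^{-2j}(t - t_j)) dt = τ^{2j} ∫⁻_{[0,T]} g` (p. 30, the computation
(2.9) "with `τ` replaced by `Mτ`"). [cite: Ozanski2017NSISingular, §2 (2.9) and §6.2 p. 30] -/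
theorem setLIntegral_Icc_switchTime_comp (hτ : 0 < τ) (T : ℝ) (j : ℕ) (g : ℝ → ℝ≥0∞) :
    ∫⁻ t in Icc (switchTime T τ j) (switchTime T τ (j + 1)),
        g (-((τ⁻¹) ^ (2 * j) * switchTime T τ j) + (τ⁻¹) ^ (2 * j) * t) =
      ENNReal.ofReal (τ ^ (2 * j)) * ∫⁻ s in Icc 0 T, g s := by
  set β : ℝ := (τ⁻¹) ^ (2 * j) with hβdef
  set a : ℝ := switchTime T τ j with hadef
  have hβ : 0 < β := pow_pos (inv_pos.2 hτ) _
  have hβτ : β * τ ^ (2 * j) = 1 := inv_pow_mul_pow_two_mul hτ.ne' j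
  have hsucc : switchTime T τ (j + 1) = a + T * τ ^ (2 * j) := switchTime_succ T τ j
  have hiff : ∀ t : ℝ, t ∈ Icc a (switchTime T τ (j + 1)) ↔ β * t + -(β * a) ∈ Icc 0 T := by
    intro t
    rw [hsucc, mem_Icc, mem_Icc]
    have e : β * t + -(β * a) = β * (t - a) := by ring
    rw [e]
    constructor
    · rintro ⟨h1, h2⟩
      refine ⟨mul_nonneg hβ.le (by linarith), ?_⟩
      calc β * (t - a) ≤ β * (T * τ ^ (2 * j)) := mul_le_mul_of_nonneg_left (by linarith) hβ.le
        _ = T := by rw [mul_comm T, ← mul_assoc, hβτ, one_mul]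
    · rintro ⟨h1, h2⟩
      have h3 : 0 ≤ t - a := by
        by_contra hlt
        have : β * (t - a) < 0 := mul_neg_of_pos_of_neg hβ (lt_of_not_ge hlt)
        linarith
      have h4 : t - a ≤ T * τ ^ (2 * j) := by
        by_contra hlt
        have : β * (T * τ ^ (2 * j)) < β * (t - a) := mul_lt_mul_of_pos_left (lt_of_not_ge hlt) hβ
        rw [mul_comm T, ← mul_assoc, hβτ, one_mul] at this
        linarith
      exact ⟨by linarith, by linarith⟩
  rw [← lintegral_indicator measurableSet_Icc, ← lintegral_indicator measurableSet_Icc]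
  have hind : (fun t => (Icc a (switchTime T τ (j + 1))).indicator
      (fun t => g (-(β * a) + β * t)) t) = fun t => (Icc 0 T).indicator g (β * t + -(β * a)) := by
    funext t
    by_cases ht : t ∈ Icc a (switchTime T τ (j + 1))
    · rw [indicator_of_mem ht, indicator_of_mem ((hiff t).1 ht)]
      congr 1
      ring
    · rw [indicator_of_notMem ht, indicator_of_notMem (mt (hiff t).2 ht)]
  -- the one-dimensional affine change of variables `s ↦ β s - β a` (Mathlib
  -- `Real.map_volume_mul_left`, `lintegral_map_equiv`, `lintegral_add_right_eq_self`)
  have h1d : ∫⁻ s, (Icc 0 T).indicator g (β * s + -(β * a)) =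
      ENNReal.ofReal |β⁻¹| * ∫⁻ t, (Icc 0 T).indicator g t := by
    have h1 : ∫⁻ s, (Icc 0 T).indicator g (β * s + -(β * a)) =
        ∫⁻ t, (Icc 0 T).indicator g (t + -(β * a)) ∂(Measure.map (fun s => β * s) volume) := by
      rw [show (fun s => β * s) = ⇑(Homeomorph.mulLeft₀ β hβ.ne').toMeasurableEquiv from rfl,
        lintegral_map_equiv]
      rfl
    rw [h1, Real.map_volume_mul_left hβ.ne', lintegral_smul_measure, smul_eq_mul,
      lintegral_add_right_eq_self (μ := (volume : Measure ℝ)) ((Icc 0 T).indicator g) (-(β * a))]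
  rw [hind, h1d, abs_of_pos (inv_pos.2 hβ), hβdef, inv_pow, inv_inv]

end Scalars

/-! #### The block -/

namespace IsNSICantorArrangement

variable {U₁ U₂ : Set (ℝ × ℝ)} {v₁ : ℝ × ℝ → ℝ × ℝ} {f₁ φ₁ : ℝ × ℝ → ℝ} {v₂ : ℝ × ℝ → ℝ × ℝ}
  {f₂ φ₂ : ℝ × ℝ → ℝ} {T τ : ℝ} {M : ℕ} {X : ℝ} {z : ℝ³} {θ ν₀ : ℝ} {h : ℝ → ℝ × ℝ → ℝ}
  {V : ℕ → ℝ → ℝ³ → ℝ³}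

/-- The generations `⋃_{m∈M(j)} Γ_m(G)` are compact. [cite: Ozanski2017NSISingular, §6.1] -/
theorem isCompact_level (hA : IsNSICantorArrangement U₁ U₂ v₁ f₁ φ₁ v₂ f₂ φ₂ T τ M X z) (j : ℕ) :
    IsCompact (CantorDust.level τ (cantorTranslate X z M) (revolve (closure U₁ ∪ closure U₂)) j) :=
  isCompact_iUnion fun m => hA.isCompact_revolve.image
    (show Continuous fun x : ℝ³ => τ ^ j • x + ∑ k : Fin j, τ ^ (k : ℕ) • cantorTranslate X z M (m k)
      from (continuous_const_smul (τ ^ j)).add continuous_const)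

/-- **(6.13) is jointly smooth on an open slab around `[t_j, t_{j+1}]`** (pull-back of
`v^{(j)} ∈ C^∞(ℝ³ × (-η, T+η))`). [cite: Ozanski2017NSISingular, §6.2 (6.13)–(6.15)] -/
theorem isSmoothSpaceTimeOn_cantorPiece (hA : IsNSICantorArrangement U₁ U₂ v₁ f₁ φ₁ v₂ f₂ φ₂ T τ M X z)
    (hL : IsNSICantorLevelFields U₁ U₂ f₁ f₂ T τ M X z θ ν₀ h V) (j : ℕ) :
    ∃ η : ℝ, 0 < η ∧ IsSmoothSpaceTimeOn
      (Ioo (switchTime T τ j - η) (switchTime T τ (j + 1) + η)) (cantorPiece T τ z V j) := by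
  obtain ⟨η, hη, hs⟩ := hL.smooth j
  have hτ := hA.τ_pos
  refine ⟨τ ^ (2 * j) * η, by positivity, ?_⟩
  have key := hs.smul_stPull ((τ⁻¹) ^ j) ((τ⁻¹) ^ (2 * j)) ((τ⁻¹) ^ j)
    (-((τ⁻¹) ^ (2 * j) * switchTime T τ j)) (-((τ⁻¹) ^ j • levelCenter τ z j))
  refine key.mono fun r hr => ?_
  simp only [mem_preimage, mem_Ioo] at hr ⊢
  have hβ : 0 < (τ⁻¹) ^ (2 * j) := pow_pos (inv_pos.2 hτ) _
  have hβτ : (τ⁻¹) ^ (2 * j) * τ ^ (2 * j) = 1 := inv_pow_mul_pow_two_mul hτ.ne' j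
  have e : -((τ⁻¹) ^ (2 * j) * switchTime T τ j) + (τ⁻¹) ^ (2 * j) * r =
      (τ⁻¹) ^ (2 * j) * (r - switchTime T τ j) := by ring
  rw [e]
  rw [switchTime_succ] at hr
  constructor
  · have h1 : -(τ ^ (2 * j) * η) < r - switchTime T τ j := by linarith [hr.1]
    calc -η = (τ⁻¹) ^ (2 * j) * -(τ ^ (2 * j) * η) := by
          rw [mul_neg, ← mul_assoc, hβτ, one_mul]
      _ < _ := mul_lt_mul_of_pos_left h1 hβ
  · have h1 : r - switchTime T τ j < τ ^ (2 * j) * (T + η) := by linarith [hr.2]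
    calc (τ⁻¹) ^ (2 * j) * (r - switchTime T τ j) < (τ⁻¹) ^ (2 * j) * (τ ^ (2 * j) * (T + η)) :=
          mul_lt_mul_of_pos_left h1 hβ
      _ = T + η := by rw [← mul_assoc, hβτ, one_mul]

/-- **The pieces are divergence free** (chain rule; Prop. 16 (i)). [cite: Ozanski2017NSISingular, §6.2 p. 29] -/
theorem isDivFree_cantorPiece (hA : IsNSICantorArrangement U₁ U₂ v₁ f₁ φ₁ v₂ f₂ φ₂ T τ M X z)
    (hL : IsNSICantorLevelFields U₁ U₂ f₁ f₂ T τ M X z θ ν₀ h V) {j : ℕ} {t : ℝ}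
    (ht : t ∈ Icc (switchTime T τ j) (switchTime T τ (j + 1))) :
    VectorCalculus.IsDivFree (cantorPiece T τ z V j t) := by
  intro x
  have hσ := localTime_mem_Icc'' hA.τ_pos (T := T) ht
  have hu1 : ContDiff ℝ 1 (V j (-((τ⁻¹) ^ (2 * j) * switchTime T τ j) + (τ⁻¹) ^ (2 * j) * t)) :=
    (hL.contDiff_slice j hσ).of_le (by norm_cast)
  have hd : DifferentiableAt ℝ (stPull ((τ⁻¹) ^ (2 * j)) ((τ⁻¹) ^ j)
      (-((τ⁻¹) ^ (2 * j) * switchTime T τ j)) (-((τ⁻¹) ^ j • levelCenter τ z j)) (V j) t) x :=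
    differentiable_stPull_slice (hu1.differentiable (by simp)) x
  rw [show cantorPiece T τ z V j t = fun y => (τ⁻¹) ^ j • stPull ((τ⁻¹) ^ (2 * j)) ((τ⁻¹) ^ j)
      (-((τ⁻¹) ^ (2 * j) * switchTime T τ j)) (-((τ⁻¹) ^ j • levelCenter τ z j)) (V j) t y from rfl,
    divergence_const_smul_apply hd, divergence_stPull, hL.divFree j _ hσ, mul_zero, mul_zero]

/-- **(6.14): the pieces vanish off the generation `⋃_{m∈M(j)} Γ_m(G)`.**
[cite: Ozanski2017NSISingular, §6.2 (6.14)] -/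
theorem cantorPiece_apply_eq_zero (hA : IsNSICantorArrangement U₁ U₂ v₁ f₁ φ₁ v₂ f₂ φ₂ T τ M X z)
    (hL : IsNSICantorLevelFields U₁ U₂ f₁ f₂ T τ M X z θ ν₀ h V) {j : ℕ} {t : ℝ}
    (ht : t ∈ Icc (switchTime T τ j) (switchTime T τ (j + 1))) {x : ℝ³}
    (hx : x ∉ CantorDust.level τ (cantorTranslate X z M) (revolve (closure U₁ ∪ closure U₂)) j) :
    cantorPiece T τ z V j t x = 0 := by
  rw [cantorPiece_apply]
  have hσ := localTime_mem_Icc' hA.τ_pos (T := T) ht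
  suffices hz : V j ((τ⁻¹) ^ (2 * j) * (t - switchTime T τ j))
      ((τ⁻¹) ^ j • (x - levelCenter τ z j)) = 0 by rw [hz, smul_zero]
  refine image_eq_zero_of_notMem_tsupport fun hmem => hx ?_
  obtain ⟨m, y, hy, hyx⟩ : ∃ m : Fin j → Fin M, ∃ y ∈ revolve (closure U₁ ∪ closure U₂),
      y + levelShift τ X z m • EuclideanSpace.single 2 1 = (τ⁻¹) ^ j • (x - levelCenter τ z j) := by
    simpa only [mem_iUnion, mem_image] using hL.tsupport_subset j _ hσ hmem
  exact mem_iUnion.2 ⟨m, y, hy, (eq_word_of_inv_pow_smul_sub_eq hA.τ_pos.ne' hyx.symm).symm⟩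

/-- The slices of the pieces have topological support in the generation (6.14).
[cite: Ozanski2017NSISingular, §6.2 (6.14)] -/
theorem tsupport_cantorPiece_subset (hA : IsNSICantorArrangement U₁ U₂ v₁ f₁ φ₁ v₂ f₂ φ₂ T τ M X z)
    (hL : IsNSICantorLevelFields U₁ U₂ f₁ f₂ T τ M X z θ ν₀ h V) {j : ℕ} {t : ℝ}
    (ht : t ∈ Icc (switchTime T τ j) (switchTime T τ (j + 1))) :
    tsupport (cantorPiece T τ z V j t) ⊆
      CantorDust.level τ (cantorTranslate X z M) (revolve (closure U₁ ∪ closure U₂)) j :=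
  closure_minimal (fun _ hx => by by_contra h'; exact hx (hA.cantorPiece_apply_eq_zero hL ht h'))
    (hA.isCompact_level j).isClosed

/-- The slices of the pieces have compact support. [folklore] -/
theorem hasCompactSupport_cantorPiece (hA : IsNSICantorArrangement U₁ U₂ v₁ f₁ φ₁ v₂ f₂ φ₂ T τ M X z)
    (hL : IsNSICantorLevelFields U₁ U₂ f₁ f₂ T τ M X z θ ν₀ h V) {j : ℕ} {t : ℝ}
    (ht : t ∈ Icc (switchTime T τ j) (switchTime T τ (j + 1))) :
    HasCompactSupport (cantorPiece T τ z V j t) :=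
  (hA.isCompact_level j).of_isClosed_subset (isClosed_tsupport _) (hA.tsupport_cantorPiece_subset hL ht)

/-- **The pressure function of a piece is the rescaled pressure function**:
`p̃[u^{(j)}(t)](x) = τ^{-2j} p̃[v^{(j)}(σ)](τ^{-j}(x - c_j))` (affine covariance of the normalised
pressure). [cite: Ozanski2017NSISingular, §6.2 (6.15) and §2 (2.4)] -/
theorem normalisedPressure_cantorPiece (hA : IsNSICantorArrangement U₁ U₂ v₁ f₁ φ₁ v₂ f₂ φ₂ T τ M X z)
    (V : ℕ → ℝ → ℝ³ → ℝ³) (j : ℕ) (t : ℝ) (x : ℝ³) :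
    normalisedPressure (cantorPiece T τ z V j t) x = ((τ⁻¹) ^ j) ^ 2 *
      normalisedPressure (V j (-((τ⁻¹) ^ (2 * j) * switchTime T τ j) + (τ⁻¹) ^ (2 * j) * t))
        (-((τ⁻¹) ^ j • levelCenter τ z j) + (τ⁻¹) ^ j • x) :=
  normalisedPressure_smul_comp_affine _ _ _ (pow_pos (inv_pos.2 hA.τ_pos) j) x

/-- **(6.15): scale covariance of the pointwise Navier–Stokes inequality** — for `ν ∈ [0,ν₀]`,
`t ∈ [t_j,t_{j+1}]` and every `x`, each term of the inequality for `u^{(j)}` at `(t,x)` is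
`τ^{-4j}` times the corresponding term of Prop. 16 (iii) for `v^{(j)}` at
`(τ^{-2j}(t - t_j), τ^{-j}(x - c_j))` ("it follows from claims (i), (iii) above that `u^{(j)}` …
satisfies the Navier–Stokes inequality"). [cite: Ozanski2017NSISingular, §6.2 (6.15)] -/
theorem nsi_cantorPiece (hA : IsNSICantorArrangement U₁ U₂ v₁ f₁ φ₁ v₂ f₂ φ₂ T τ M X z)
    (hL : IsNSICantorLevelFields U₁ U₂ f₁ f₂ T τ M X z θ ν₀ h V) {ν : ℝ} (hν : ν ∈ Icc 0 ν₀)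
    {j : ℕ} {s : ℝ} (hs : s ∈ Icc (switchTime T τ j) (switchTime T τ (j + 1))) (x : ℝ³) :
    timeDeriv (fun r y => ‖cantorPiece T τ z V j r y‖ ^ 2) s x ≤
      -⟪cantorPiece T τ z V j s x, gradient (fun y => ‖cantorPiece T τ z V j s y‖ ^ 2 +
          2 * normalisedPressure (cantorPiece T τ z V j s) y) x⟫ +
        2 * ν * ⟪cantorPiece T τ z V j s x, Δ (cantorPiece T τ z V j s) x⟫ := by
  -- abbreviations
  set α : ℝ := (τ⁻¹) ^ j with hα
  set β : ℝ := (τ⁻¹) ^ (2 * j) with hβ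
  set t₀ : ℝ := -(β * switchTime T τ j) with ht₀
  set x₁ : ℝ³ := -(α • levelCenter τ z j) with hx₁
  have hαpos : 0 < α := pow_pos (inv_pos.2 hA.τ_pos) j
  have hβpos : 0 < β := pow_pos (inv_pos.2 hA.τ_pos) _
  have hβα : β = α ^ 2 := by rw [hβ, hα, ← pow_mul, mul_comm]
  have hw : cantorPiece T τ z V j = α • stPull β α t₀ x₁ (V j) := rfl
  set σ : ℝ := t₀ + β * s with hσdef
  set y : ℝ³ := x₁ + α • x with hydef
  have hσ : σ ∈ Icc 0 T := localTime_mem_Icc'' hA.τ_pos hs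
  -- Prop. 16 (iii) at `(σ, y)`
  have hblock := hL.nsi j ν hν σ hσ y
  -- regularity of the slice `v^{(j)}(σ)` and of its pressure
  have huσ : ContDiff ℝ ∞ (V j σ) := hL.contDiff_slice j hσ
  have hu2 : ContDiff ℝ 2 (V j σ) := huσ.of_le (by norm_cast)
  have huc : HasCompactSupport (V j σ) := hL.hasCompactSupport_slice hA.isCompact_revolve j hσ
  have hp2 : ContDiff ℝ 2 (normalisedPressure (V j σ)) :=
    contDiff_normalisedPressure_of_hasCompactSupport huσ huc
  set Q : ℝ³ → ℝ := fun w => ‖V j σ w‖ ^ 2 + 2 * normalisedPressure (V j σ) w with hQdef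
  have hQd : Differentiable ℝ Q :=
    ((hu2.differentiable (by norm_num)).norm_sq ℝ).add
      ((hp2.differentiable (by norm_num)).const_mul 2)
  -- (1) the time derivative of `|u^{(j)}|²`
  have e1 : (fun r w => ‖cantorPiece T τ z V j r w‖ ^ 2) =
      (α ^ 2) • stPull β α t₀ x₁ (fun r w => ‖V j r w‖ ^ 2) := by
    funext r w
    simp only [hw, smul_stPull_apply, smul_eq_mul, norm_smul, Real.norm_eq_abs, mul_pow, sq_abs]
  have hT : timeDeriv (fun r w => ‖cantorPiece T τ z V j r w‖ ^ 2) s x =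
      (α ^ 2 * β) * timeDeriv (fun r w => ‖V j r w‖ ^ 2) σ y := by
    rw [e1, timeDeriv_eq_timeDerivWithin_univ, timeDeriv_eq_timeDerivWithin_univ]
    have := timeDerivWithin_smul_stPull (univ : Set ℝ) (fun r w => ‖V j r w‖ ^ 2) (α ^ 2)
      (β := β) hβpos.ne' α t₀ x₁ s x
    rw [preimage_univ] at this
    rw [this, smul_eq_mul]
  -- (2) the gradient term
  have e2 : (fun w => ‖cantorPiece T τ z V j s w‖ ^ 2 +
      2 * normalisedPressure (cantorPiece T τ z V j s) w) =
      fun w => (α ^ 2) • stPull β α t₀ x₁ (fun (_ : ℝ) w' => Q w') s w := by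
    funext w
    rw [hA.normalisedPressure_cantorPiece V j s w]
    simp only [hw, smul_stPull_apply, stPull_apply, smul_eq_mul, norm_smul, Real.norm_eq_abs,
      mul_pow, sq_abs, hQdef]
    ring
  have hG : gradient (fun w => ‖cantorPiece T τ z V j s w‖ ^ 2 +
      2 * normalisedPressure (cantorPiece T τ z V j s) w) x = (α ^ 2 * α) • gradient Q y := by
    rw [e2]
    have hd : DifferentiableAt ℝ (stPull β α t₀ x₁ (fun (_ : ℝ) w' => Q w') s) x :=
      differentiable_stPull_slice (u := fun (_ : ℝ) w' => Q w') hQd x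
    rw [gradient_const_smul hd, gradient_stPull, smul_smul]
  -- (3) the Laplacian
  have hΔ : Δ (cantorPiece T τ z V j s) x = (α * α ^ 2) • Δ (V j σ) y := by
    have hu2' : ContDiffAt ℝ 2 (stPull β α t₀ x₁ (V j) s) x := (contDiff_stPull_slice hu2).contDiffAt
    rw [hw, show (α • stPull β α t₀ x₁ (V j)) s = α • stPull β α t₀ x₁ (V j) s from rfl,
      InnerProductSpace.laplacian_smul α hu2', laplacian_stPull β α t₀ x₁ (V j) s x hu2, smul_smul]
  -- (4) the value
  have hv : cantorPiece T τ z V j s x = α • V j σ y := rfl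
  -- assemble
  rw [hT, hG, hΔ, hv]
  simp only [inner_smul_left, inner_smul_right, RCLike.conj_to_real]
  have key : α ^ 2 * β * timeDeriv (fun r w => ‖V j r w‖ ^ 2) σ y ≤
      α ^ 2 * β * (-⟪V j σ y, gradient Q y⟫ + 2 * ν * ⟪V j σ y, Δ (V j σ) y⟫) :=
    mul_le_mul_of_nonneg_left hblock (mul_nonneg (pow_nonneg hαpos.le 2) hβpos.le)
  have e3 : α ^ 2 * β * (-⟪V j σ y, gradient Q y⟫ + 2 * ν * ⟪V j σ y, Δ (V j σ) y⟫) =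
      -(α ^ 2 * α * (α * ⟪V j σ y, gradient Q y⟫)) +
        2 * ν * (α * α ^ 2 * (α * ⟪V j σ y, Δ (V j σ) y⟫)) := by
    rw [hβα]; ring
  rw [e3] at key
  exact key

/-- **(6.16): the magnitude drops at the switching times**,
`|u^{(j+1)}(x, t_{j+1})| ≤ |u^{(j)}(x, t_{j+1})|` (Ożański p. 29–30: trivial off
`⋃_{m∈M(j+1)} Γ_m(G)`; for `x = Γ_m(y) = Γ_{m̄}(Γ_n y)`, `|u^{(j+1)}(x,t_{j+1})| = τ^{-(j+1)}h₀(R⁻¹y)`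
by (ii), while `|u^{(j)}(x,t_{j+1})|² > τ^{-2j}(h_T(R⁻¹Γ_n y)² - θ) > τ^{-2(j+1)}h₀(R⁻¹y)²` by
(ii) and (6.12); Scheffer 1987, Lemma 5.7). [cite: Ozanski2017NSISingular, §6.2 (6.16)]
[cite: Scheffer1987, Lemma 5.7] -/
theorem norm_cantorPiece_succ_le (hA : IsNSICantorArrangement U₁ U₂ v₁ f₁ φ₁ v₂ f₂ φ₂ T τ M X z)
    (hL : IsNSICantorLevelFields U₁ U₂ f₁ f₂ T τ M X z θ ν₀ h V) (j : ℕ) (x : ℝ³) :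
    ‖cantorPiece T τ z V (j + 1) (switchTime T τ (j + 1)) x‖ ≤
      ‖cantorPiece T τ z V j (switchTime T τ (j + 1)) x‖ := by
  have hτ := hA.τ_pos
  by_cases hx : x ∈ CantorDust.level τ (cantorTranslate X z M) (revolve (closure U₁ ∪ closure U₂)) (j + 1)
  · obtain ⟨m, y, hy, rfl⟩ : ∃ m : Fin (j + 1) → Fin M, ∃ y ∈ revolve (closure U₁ ∪ closure U₂),
        CantorDust.word τ (cantorTranslate X z M) m y = x := by
      simpa only [CantorDust.level, mem_iUnion, mem_image] using hx
    -- the new piece at the start of its life span: `τ^{-(j+1)} h₀(R⁻¹y)`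
    have hleft : cantorPiece T τ z V (j + 1) (switchTime T τ (j + 1))
        (CantorDust.word τ (cantorTranslate X z M) m y) =
        (τ⁻¹) ^ (j + 1) • V (j + 1) 0 (y + levelShift τ X z m • EuclideanSpace.single 2 1) := by
      rw [cantorPiece_apply_word hτ.ne', sub_self, mul_zero]
    -- the old piece at the end of its life span, on the component `Γ_{m̄}(G) ∋ x = Γ_{m̄}(Γ_n y)`
    have hy₁ : τ • y + cantorTranslate X z M (m (Fin.last j)) ∈ revolve (closure U₁ ∪ closure U₂) :=
      hA.mapsTo (m (Fin.last j)) hy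
    have hright : cantorPiece T τ z V j (switchTime T τ (j + 1))
        (CantorDust.word τ (cantorTranslate X z M) m y) =
        (τ⁻¹) ^ j • V j T (τ • y + cantorTranslate X z M (m (Fin.last j)) +
          levelShift τ X z (Fin.init m) • EuclideanSpace.single 2 1) := by
      rw [word_eq_word_init τ (cantorTranslate X z M) m y, cantorPiece_apply_word hτ.ne',
        localTime_switchTime_succ hτ.ne']
    rw [hleft, hright, norm_smul, norm_smul, hL.norm_zero (j + 1) y hy m,
      Real.norm_of_nonneg (pow_nonneg (inv_nonneg.2 hτ.le) _),
      Real.norm_of_nonneg (pow_nonneg (inv_nonneg.2 hτ.le) _)]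
    have hgain := hL.gain y hy (m (Fin.last j))
    have hsq := (abs_lt.1 (hL.abs_sq_sub_lt j T ⟨hA.T_pos.le, le_rfl⟩ _ hy₁ (Fin.init m))).1
    have h0 : 0 ≤ h 0 (meridian y) := by
      rw [hL.h_zero]
      exact add_nonneg (hA.structure₁.f_nonneg _) (hA.structure₂.f_nonneg _)
    have h1 : (τ⁻¹ * h 0 (meridian y)) ^ 2 < ‖V j T (τ • y + cantorTranslate X z M (m (Fin.last j)) +
        levelShift τ X z (Fin.init m) • EuclideanSpace.single 2 1)‖ ^ 2 := by
      rw [mul_pow]; linarith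
    have h2 := lt_of_pow_lt_pow_left₀ 2 (norm_nonneg _) h1
    rw [pow_succ, mul_assoc]
    exact mul_le_mul_of_nonneg_left h2.le (pow_nonneg (inv_nonneg.2 hτ.le) _)
  · have ht : switchTime T τ (j + 1) ∈ Icc (switchTime T τ (j + 1)) (switchTime T τ (j + 1 + 1)) :=
      ⟨le_rfl, (strictMono_switchTime hA.T_pos hτ (Nat.lt_succ_self _)).le⟩
    rw [hA.cantorPiece_apply_eq_zero hL ht hx, norm_zero]
    exact norm_nonneg _

/-- **The energy of a piece** (p. 30, (2.8) "with `τ` replaced by `Mτ`"):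
`∫|u^{(j)}(t)|² = τʲ ∫|v^{(j)}(σ)|² ≤ τʲ 𝒞 Mʲ ≤ 𝒞`. [cite: Ozanski2017NSISingular, §6.2 p. 30] -/
theorem lintegral_enorm_sq_cantorPiece_le (hA : IsNSICantorArrangement U₁ U₂ v₁ f₁ φ₁ v₂ f₂ φ₂ T τ M X z)
    (V : ℕ → ℝ → ℝ³ → ℝ³) {C : ℝ≥0}
    (hC : ∀ j : ℕ, ∀ s ∈ Icc (0 : ℝ) T, ∫⁻ x, ‖V j s x‖ₑ ^ 2 ≤ (C : ℝ≥0∞) * (M : ℝ≥0∞) ^ j)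
    {j : ℕ} {t : ℝ} (ht : t ∈ Icc (switchTime T τ j) (switchTime T τ (j + 1))) :
    ∫⁻ x, ‖cantorPiece T τ z V j t x‖ₑ ^ 2 ≤ C := by
  have hτ := hA.τ_pos
  set α : ℝ := (τ⁻¹) ^ j with hα
  set β : ℝ := (τ⁻¹) ^ (2 * j) with hβ
  set t₀ : ℝ := -(β * switchTime T τ j) with ht₀
  set x₁ : ℝ³ := -(α • levelCenter τ z j) with hx₁
  have hαpos : 0 < α := pow_pos (inv_pos.2 hτ) j
  have hσ : t₀ + β * t ∈ Icc 0 T := localTime_mem_Icc'' hτ ht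
  have e : ∀ x, ‖cantorPiece T τ z V j t x‖ₑ ^ 2 = ‖α‖ₑ ^ 2 * ‖V j (t₀ + β * t) (x₁ + α • x)‖ₑ ^ 2 :=
    fun x => by
      rw [show cantorPiece T τ z V j t x = α • V j (t₀ + β * t) (x₁ + α • x) from rfl, enorm_smul,
        mul_pow]
  simp_rw [e]
  rw [lintegral_const_mul' _ _ (by simp),
    lintegral_comp_space_affine hαpos x₁ (fun w => ‖V j (t₀ + β * t) w‖ₑ ^ 2), ← mul_assoc,
    finrank_euclideanSpace_fin, enorm_sq_mul_ofReal_inv_pow_three hαpos, hα, inv_pow, inv_inv]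
  exact (mul_le_mul_of_nonneg_left (hC j _ hσ) zero_le).trans
    (ofReal_pow_mul_le hτ hA.τ_mul_lt_one _ j)

/-- **The dissipation of a piece** (p. 30, (2.9) "with `τ` replaced by `Mτ`"):
`∫_{t_j}^{t_{j+1}}∫|∇u^{(j)}|² = τʲ ∫₀ᵀ∫|∇v^{(j)}|² ≤ τʲ 𝒞 Mʲ`. [cite: Ozanski2017NSISingular, §6.2 p. 30] -/
theorem lintegral_dissipation_cantorPiece_le (hA : IsNSICantorArrangement U₁ U₂ v₁ f₁ φ₁ v₂ f₂ φ₂ T τ M X z)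
    (hL : IsNSICantorLevelFields U₁ U₂ f₁ f₂ T τ M X z θ ν₀ h V) {C : ℝ≥0}
    (hC : ∀ j : ℕ, (∫⁻ s in Icc (0 : ℝ) T, ∫⁻ x, ENNReal.ofReal (frobeniusNormSq (fderiv ℝ (V j s) x))) ≤
      (C : ℝ≥0∞) * (M : ℝ≥0∞) ^ j) (j : ℕ) :
    (∫⁻ t in Icc (switchTime T τ j) (switchTime T τ (j + 1)),
      ∫⁻ x, ENNReal.ofReal (frobeniusNormSq (fderiv ℝ (cantorPiece T τ z V j t) x))) ≤
      ENNReal.ofReal (τ ^ j) * ((C : ℝ≥0∞) * (M : ℝ≥0∞) ^ j) := by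
  have hτ := hA.τ_pos
  set α : ℝ := (τ⁻¹) ^ j with hα
  set β : ℝ := (τ⁻¹) ^ (2 * j) with hβ
  set t₀ : ℝ := -(β * switchTime T τ j) with ht₀
  set x₁ : ℝ³ := -(α • levelCenter τ z j) with hx₁
  have hαpos : 0 < α := pow_pos (inv_pos.2 hτ) j
  set g : ℝ → ℝ≥0∞ := fun σ => ∫⁻ x, ENNReal.ofReal (frobeniusNormSq (fderiv ℝ (V j σ) x)) with hg
  -- the inner (space) integral at a fixed time
  have hinner : ∀ t ∈ Icc (switchTime T τ j) (switchTime T τ (j + 1)),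
      ∫⁻ x, ENNReal.ofReal (frobeniusNormSq (fderiv ℝ (cantorPiece T τ z V j t) x)) =
        ENNReal.ofReal α * g (t₀ + β * t) := by
    intro t ht
    have hσ : t₀ + β * t ∈ Icc 0 T := localTime_mem_Icc'' hτ ht
    have hdiff : Differentiable ℝ (V j (t₀ + β * t)) :=
      (hL.contDiff_slice j hσ).differentiable (by simp)
    have e : ∀ x, ENNReal.ofReal (frobeniusNormSq (fderiv ℝ (cantorPiece T τ z V j t) x)) =
        ENNReal.ofReal ((α * α) ^ 2) *
          ENNReal.ofReal (frobeniusNormSq (fderiv ℝ (V j (t₀ + β * t)) (x₁ + α • x))) := by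
      intro x
      have hfd : fderiv ℝ (cantorPiece T τ z V j t) x =
          (α * α) • fderiv ℝ (V j (t₀ + β * t)) (x₁ + α • x) := by
        rw [show cantorPiece T τ z V j t = fun y => α • stPull β α t₀ x₁ (V j) t y from rfl,
          fderiv_fun_const_smul (differentiable_stPull_slice hdiff x), fderiv_stPull, smul_smul]
      rw [hfd, frobeniusNormSq_smul, ENNReal.ofReal_mul (sq_nonneg _)]
    simp_rw [e]
    rw [lintegral_const_mul' _ _ ENNReal.ofReal_ne_top,
      lintegral_comp_space_affine hαpos x₁
        (fun w => ENNReal.ofReal (frobeniusNormSq (fderiv ℝ (V j (t₀ + β * t)) w))),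
      ← mul_assoc, finrank_euclideanSpace_fin, ← ENNReal.ofReal_mul (sq_nonneg _)]
    congr 2
    field_simp
  calc (∫⁻ t in Icc (switchTime T τ j) (switchTime T τ (j + 1)),
        ∫⁻ x, ENNReal.ofReal (frobeniusNormSq (fderiv ℝ (cantorPiece T τ z V j t) x)))
      = ∫⁻ t in Icc (switchTime T τ j) (switchTime T τ (j + 1)), ENNReal.ofReal α * g (t₀ + β * t) :=
        setLIntegral_congr_fun measurableSet_Icc hinner
    _ = ENNReal.ofReal α * (ENNReal.ofReal (τ ^ (2 * j)) * ∫⁻ s in Icc 0 T, g s) := by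
        rw [lintegral_const_mul' _ _ ENNReal.ofReal_ne_top, setLIntegral_Icc_switchTime_comp hτ T j g]
    _ = ENNReal.ofReal (τ ^ j) * ∫⁻ s in Icc 0 T, g s := by
        have hscal : (τ⁻¹) ^ j * τ ^ (2 * j) = τ ^ j := by
          rw [pow_mul', sq, ← mul_assoc, inv_pow, inv_mul_cancel₀ (pow_ne_zero _ hτ.ne'), one_mul]
        rw [← mul_assoc, ← ENNReal.ofReal_mul hαpos.le, hα, hscal]
    _ ≤ ENNReal.ofReal (τ ^ j) * ((C : ℝ≥0∞) * (M : ℝ≥0∞) ^ j) :=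
        mul_le_mul_of_nonneg_left (hC j) zero_le

/-- **The block from the level data** (Ożański 2017, §6.2, pp. 29–30: given Prop. 16 and the
rescaling (6.13), the pieces `u^{(j)}` are `C^∞` on `ℝ³ × [t_j,t_{j+1}]`, divergence free,
satisfy the NSI (6.15) for every `ν ∈ [0,ν₀]`, have supports (6.14) in `⋃_{m∈M(j)} Γ_m(G)`, drop
at the switching times (6.16), grow uniformly — `|u^{(j)}(Γ_m(y), t_j)| = τ^{-j} h₀(R⁻¹y)` at the
point `y ∈ G` with `h₀(R⁻¹y) > 0` of p. 30 — and obey `sup_{j,t}‖u^{(j)}(t)‖² ≤ 𝒞`,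
`Σ_j ∫‖∇u^{(j)}‖² ≤ 𝒞 Σ_j (τM)ʲ < ∞`; Scheffer 1987, (5.34)–(5.38) with Lemmas 5.6–5.8). PROVED.
[cite: Ozanski2017NSISingular, §6.2 (6.13)–(6.17) and p. 30] [cite: Scheffer1987, Lemmas 5.6–5.8] -/
theorem isNSICantorBlock_of_levelFields
    (hA : IsNSICantorArrangement U₁ U₂ v₁ f₁ φ₁ v₂ f₂ φ₂ T τ M X z)
    (hL : IsNSICantorLevelFields U₁ U₂ f₁ f₂ T τ M X z θ ν₀ h V) :
    IsNSICantorBlock T ν₀ τ M (cantorTranslate X z M) (revolve (closure U₁ ∪ closure U₂))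
      (cantorPiece T τ z V) where
  T_pos := hA.T_pos
  ν₀_pos := hL.ν₀_pos
  τ_pos := hA.τ_pos
  τ_lt_one := hA.τ_lt_one
  isCompact := hA.isCompact_revolve
  mapsTo := hA.mapsTo
  disjoint := hA.disjoint_image
  smooth := hA.isSmoothSpaceTimeOn_cantorPiece hL
  divFree _ _ ht := hA.isDivFree_cantorPiece hL ht
  tsupport_subset _ _ ht := hA.tsupport_cantorPiece_subset hL ht
  nsi _ _ hν _ ht x := hA.nsi_cantorPiece hL hν ht x
  drop := hA.norm_cantorPiece_succ_le hL
  energy := by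
    obtain ⟨C, hC⟩ := hL.energy
    exact ⟨C, fun j t ht => hA.lintegral_enorm_sq_cantorPiece_le V hC ht⟩
  dissipation := by
    obtain ⟨C, hC⟩ := hL.dissipation
    have hτ := hA.τ_pos
    have hτM : ENNReal.ofReal (τ * M) < 1 := ENNReal.ofReal_lt_one.2 hA.τ_mul_lt_one
    calc (∑' j : ℕ, ∫⁻ t in Icc (switchTime T τ j) (switchTime T τ (j + 1)),
          ∫⁻ x, ENNReal.ofReal (frobeniusNormSq (fderiv ℝ (cantorPiece T τ z V j t) x)))
        ≤ ∑' j : ℕ, ENNReal.ofReal (τ ^ j) * ((C : ℝ≥0∞) * (M : ℝ≥0∞) ^ j) :=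
          ENNReal.tsum_le_tsum fun j => hA.lintegral_dissipation_cantorPiece_le hL hC j
      _ = ∑' j : ℕ, (C : ℝ≥0∞) * ENNReal.ofReal (τ * M) ^ j := by
          refine tsum_congr fun j => ?_
          rw [← ofReal_pow_mul_natCast_pow hτ M j]
          ring
      _ = (C : ℝ≥0∞) * ∑' j : ℕ, ENNReal.ofReal (τ * M) ^ j := ENNReal.tsum_mul_left
      _ < ⊤ := by
          rw [ENNReal.tsum_geometric]
          exact ENNReal.mul_lt_top ENNReal.coe_lt_top
            (ENNReal.inv_lt_top.2 (tsub_pos_of_lt hτM))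
  growth := by
    obtain ⟨y, hy, hpos⟩ := hA.exists_add_pos
    refine ⟨y, hy, f₁ (meridian y) + f₂ (meridian y), hpos, fun j m => le_of_eq ?_⟩
    rw [cantorPiece_apply_word hA.τ_pos.ne', sub_self, mul_zero, norm_smul, hL.norm_zero j y hy m,
      hL.h_zero, Real.norm_of_nonneg (pow_nonneg (inv_nonneg.2 hA.τ_pos.le) _), mul_comm]

end IsNSICantorArrangement


/-! ### The two named facts and the assembly of `NSICantorBlockExists` -/

/-- **Fact C′ — existence of the geometric arrangement for Theorem 14** (Ożański 2017, §6.5,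
Steps 1–5 with Lemma 18, on top of the objects of §5: the base structure `(v,f,φ)` on `U`
(Thm. 3.4), `F = F[v,f]` with the constants `A, B, C, D` (Lemma 3.5), `κ = 10⁴C/D`, the copies
`U^{a',r'}, U^{a'',r''}` and `H` with (i)–(vi) of §5.2, `E`; then `X` large ((6.33): `X >
diam(U ∪ U^{a',r'} ∪ U^{a'',r''})`, `X > 4|A|`, `2CX⁻⁴Σ(|k|-1/2)⁻⁴ < 0.01B`, `X > 2κE`), `M` disjoint
copies in the `x₁` direction, Lemma 18 (the far copies interact by `< 0.01B`), `τ = 0.48ε`,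
`r = E/ε`, `d = κr`, `M = 1 + d/(4X)` ((6.35)), `ε` small with `τ^ξ M ≥ 1`,
`ε²M < 10⁻⁶BE⁴/2C` ((6.36)) — whence `τM < 1` —, `v₂` of Lemma 5.2, the ring `U₂`,
`U₁ = ⋃ₙ(U^{nX} ∪ U^{a'+nX,r'} ∪ U^{a''+nX,r''}) ∪ U^{a,r}` (Step 4), `z = (A, εr/2, 0)` and
(6.3) (Step 5), `f₂, φ₂, T` as in §5.5 verifying (6.6)–(6.7); Scheffer 1987, §4, Lemmas
4.1–4.18 with (4.8), (4.32)–(4.33), and (5.1)–(5.7), Lemma 5.1). For every `ξ ∈ (0,1)` there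
is a geometric arrangement for Theorem 14 with `τ^ξ M ≥ 1`. Nothing asserted.
[cite: Ozanski2017NSISingular, §6.5 (Steps 1–5, Lemma 18, (6.33)–(6.36))]
[cite: Scheffer1987, §4 (Lemmas 4.1–4.18) and (5.1)–(5.7)] -/
def NSICantorArrangementExists : Prop :=
  ∀ ξ : ℝ, 0 < ξ → ξ < 1 →
    ∃ (U₁ U₂ : Set (ℝ × ℝ)) (v₁ : ℝ × ℝ → ℝ × ℝ) (f₁ φ₁ : ℝ × ℝ → ℝ) (v₂ : ℝ × ℝ → ℝ × ℝ)
      (f₂ φ₂ : ℝ × ℝ → ℝ) (T τ : ℝ) (M : ℕ) (X : ℝ) (z : ℝ³),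
      1 ≤ τ ^ ξ * M ∧ IsNSICantorArrangement U₁ U₂ v₁ f₁ φ₁ v₂ f₂ φ₂ T τ M X z

/-- **Fact D′ — the level data of an arrangement** (Ożański 2017, §6.2, pp. 28–29, given the
arrangement: `θ > 0` by (6.8); `h_t = h_{1,t} + h_{2,t}` by (6.9)–(6.11) with `δ > 0` "as in
Lemma 4.1", so that `(vᵢ, h_{i,t}, φᵢ)` are structures for `t ∈ (-δ, T+δ)`, `h₀ = f₁ + f₂`, and
(6.12) holds; `ν₀ > 0` by (4.13); and **Proposition 16** — proved in §6.3 (Step 1: the `Mʲ`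
pairwise disjoint axial translates `K^𝔪` of `Ū₁ ∪ Ū₂` and the translated structures; Step 2:
the modifications `q^{𝔪,k}_{i,t}` of `h^𝔪_{i,t}` driven by the new oscillatory processes
`a_i^{𝔪,k}` of **Theorem 17**, §6.4, with `q^{𝔪,k} → h^𝔪` uniformly with derivatives; Step 3:
`v = Σ_𝔪 (u[a₁^{𝔪,k}v₁^𝔪, q₁^{𝔪,k}] + u[a₂^{𝔪,k}v₂^𝔪, q₂^{𝔪,k}])`, the verification of (i)–(iv)
via Cases 1–2, Lemma 3.1, the continuity lemmas of Appendix A and (4.13)) —: for every `j ≥ 0`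
a field `v^{(j)} ∈ C^∞(ℝ³ × [0,T]; ℝ³)` with (i)–(iv) (`IsNSICantorLevelFields`; (iv) with the
constant `𝒞Mʲ` of the printed proof). Scheffer 1987: Lemma 5.5 (the fields `v^Z, q^Z` from the
oscillatory process of Lemma 3.2) for the configurations `Z` of (5.26)–(5.33). For every
geometric arrangement for Theorem 14 there are `θ, ν₀, h, V` forming level data
`IsNSICantorLevelFields U₁ U₂ f₁ f₂ T τ M X z θ ν₀ h V`. Its `j = 0` instance is the one-point
fact D = D-I + D-II of `NavierStokesInequalityProfiles` (Prop. 16 "is a generalisation of …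
Proposition 4.2, which is recovered by taking `j = 0`"). Nothing asserted.
RESTATED 2026-08-15 (review of the decomposition under D-0026; the declaration name is kept):
the former statement "every arrangement carries a Cantor block `IsNSICantorBlock`" bundled this
fact with the rescaling (6.13)–(6.17), which is now PROVED
(`IsNSICantorArrangement.isNSICantorBlock_of_levelFields`); the former statement is the corollary
`isNSICantorBlock_of_nsiCantorBlock_of_arrangement` below.
[cite: Ozanski2017NSISingular, §6.2 ((6.8)–(6.12), Prop. 16), §6.3 (Steps 1–3), §6.4 (Thm. 17)]
[cite: Scheffer1987, Lemmas 3.2 and 5.5] -/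
def NSICantorBlock_of_arrangement : Prop :=
  ∀ (U₁ U₂ : Set (ℝ × ℝ)) (v₁ : ℝ × ℝ → ℝ × ℝ) (f₁ φ₁ : ℝ × ℝ → ℝ) (v₂ : ℝ × ℝ → ℝ × ℝ)
    (f₂ φ₂ : ℝ × ℝ → ℝ) (T τ : ℝ) (M : ℕ) (X : ℝ) (z : ℝ³),
    IsNSICantorArrangement U₁ U₂ v₁ f₁ φ₁ v₂ f₂ φ₂ T τ M X z →
    ∃ (θ ν₀ : ℝ) (h : ℝ → ℝ × ℝ → ℝ) (V : ℕ → ℝ → ℝ³ → ℝ³),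
      IsNSICantorLevelFields U₁ U₂ f₁ f₂ T τ M X z θ ν₀ h V

/-- **The former statement of fact D′, now a corollary (proved): every arrangement carries a
Cantor block** `IsNSICantorBlock T ν₀ τ M Γ G w` on `G = R(Ū₁ ∪ Ū₂)` for the similarities
`Γ_n(x) = τx + cantorTranslate X z M n`, namely the rescaled pieces (6.13) of its level data
(Ożański 2017, §6.2: "We now show how Theorem 14 follows (given the geometric arrangement)").
[cite: Ozanski2017NSISingular, §6.2 (Prop. 16, (6.13)–(6.17), p. 30)] -/
theorem isNSICantorBlock_of_nsiCantorBlock_of_arrangement (hD : NSICantorBlock_of_arrangement)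
    {U₁ U₂ : Set (ℝ × ℝ)} {v₁ : ℝ × ℝ → ℝ × ℝ} {f₁ φ₁ : ℝ × ℝ → ℝ} {v₂ : ℝ × ℝ → ℝ × ℝ}
    {f₂ φ₂ : ℝ × ℝ → ℝ} {T τ : ℝ} {M : ℕ} {X : ℝ} {z : ℝ³}
    (hA : IsNSICantorArrangement U₁ U₂ v₁ f₁ φ₁ v₂ f₂ φ₂ T τ M X z) :
    ∃ (ν₀ : ℝ) (w : ℕ → ℝ → ℝ³ → ℝ³),
      IsNSICantorBlock T ν₀ τ M (cantorTranslate X z M) (revolve (closure U₁ ∪ closure U₂)) w := by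
  obtain ⟨θ, ν₀, h, V, hL⟩ := hD U₁ U₂ v₁ f₁ φ₁ v₂ f₂ φ₂ T τ M X z hA
  exact ⟨ν₀, _, hA.isNSICantorBlock_of_levelFields hL⟩

/-- **Assembly (proved): fact B′ from facts C′ and D′.** The geometric arrangement of §6.5, the
level data of §6.2–§6.4 and the rescaling (6.13) give, for every `ξ ∈ (0,1)`, a Cantor block with
`τ^ξ M ≥ 1`, `τM < 1`, `X > 0`, `z 1 = 0`, i.e. `NSICantorBlockExists` (Ożański 2017, §6.2: "We
now show how Theorem 14 follows (given the geometric arrangement)"; Scheffer 1987, p. 551).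
[cite: Ozanski2017NSISingular, §6.2 p. 28] -/
theorem nsiCantorBlockExists_of_arrangement (hC : NSICantorArrangementExists)
    (hD : NSICantorBlock_of_arrangement) : NSICantorBlockExists := by
  intro ξ hξ₀ hξ₁
  obtain ⟨U₁, U₂, v₁, f₁, φ₁, v₂, f₂, φ₂, T, τ, M, X, z, hξM, hA⟩ := hC ξ hξ₀ hξ₁
  obtain ⟨ν₀, w, hw⟩ := isNSICantorBlock_of_nsiCantorBlock_of_arrangement hD hA
  exact ⟨T, ν₀, τ, M, X, z, _, w, hξM, hA.τ_mul_lt_one, hA.X_pos, hA.z_apply_one, hw⟩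

end Literature.Barriers.NavierStokesRegularity
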